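import Literature.MathematicalPhysics.PowerSystems.DVOCLineConvergence
import HarnessLib

/-!
# Reduced-order dVOC networks: every solution approaches `𝒮 ∩ 𝒜` or the origin
# (Groß–Colombino–Brouillon–Dörfler 2019, Prop. 3 + Thm. 1; Colombino–Groß–Brouillon–Dörfler 2019, Thm. 1)

Topic `Literature/MathematicalPhysics/PowerSystems`, namespace
`Literature.MathematicalPhysics.PowerSystems.DvocReduced` (the parameter record of
`DVOCReducedNetworkLyapunov.lean`). THREE COLUMNS: MODELLED-column mathematics about the printed
REDUCED-ORDER model (17) (`N` dVOC converters on a quasi-steady-state network, Assumption 1,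
consistent set-points); no declaration says that a converter or a grid is stable. 0 named facts: every
theorem is PROVED, from the tree's Prop. 3 (`DvocReduced.hasDerivWithinAt_V_le`: `V̇ ≤ −α₁ψ(v)²` along
(17)), the zero sets of `V` and `ψ` (`V_eq_zero_iff`, `psi_eq_zero_iff`), and the tree's a-priori
Lyapunov theorem for compact sets `Literature.Analysis.ODE.DissipativeCurve.*`
(= [GrossEtAl2019, Thm. 1], deterministic content).

Sources (held, read on the page; `pNNNN` = PDF page of arXiv:1802.08881 / LaTeX chunk of
arXiv:1710.00694):
* [GrossEtAl2019] §IV-D Prop. 3 p0006 L82–L104 («V … is positive definite with respect to 𝒮 ∩ 𝒜 …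
  radially unbounded … 𝒮 ∩ 𝒜 is a compact set … (d/dt)V ≤ −α₁ψ(v)² (25)»); §III Thm. 1 p0004.
* [ColombinoEtAl2019] M. Colombino, D. Groß, J.-S. Brouillon, F. Dörfler, *Global phase and magnitude
  synchronization of coupled oscillators with application to the control of grid-forming power
  inverters*, IEEE TAC 64 (2019) = arXiv:1710.00694, Thm. 1 (main result: almost global asymptotic
  stability of `𝒯` for the reduced voltage dynamics) and Props. 8–10 (chunks p0015, p0021).

## What is proved (every `N ≥ 1`)

Hypotheses = those of the tree's Prop. 3 (`η > 0`, `α > 0`, `v_k* > 0`, margin `c > 0` with the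
decrease inequality (23) `DecreaseOnS c`, phase-error bound `κ₀ > 0` with `PhaseErrorBound κ₀`;
`α₁ = c/(5ηκ₀²)` as printed (20)). For EVERY solution `v(t)` of (17) on `[0, ∞)`:
* `isCompact_target`, `isCompact_V_sublevel` — `𝒯 = 𝒮 ∩ 𝒜` is compact; every sublevel set of `V`
  (19) is compact («radially unbounded», the `𝒦∞` bound (24));
* **`tendsto_infDist_target_or_tendsto_zero`** — THE DICHOTOMY `dist(v(t), 𝒮 ∩ 𝒜) → 0` or
  `v(t) → 0` (deterministic content of «almost globally asymptotically stable w.r.t. 𝒯»);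
* **`tendsto_infDist_target_of_V_lt`** — the explicit region of attraction `{V < V(0)}`,
  `V(0) = ½ηαα₁Σ_k v_k*²` (Summits-side twin, not importable into Literature:
  `Summit.Ventures.GridStability.Lyapunov.DvocReducedRoa.tendsto_infDist_target`, proved there by a
  curve-form trapping argument; here a one-line corollary of the dichotomy machinery);
* **`target_stable`** — `𝒮 ∩ 𝒜` is Lyapunov stable, uniformly over solutions;
* `tendsto_infDist_target_of_condition2` — both under Condition 2's first inequality AS PRINTED
  (tree `decreaseOnS_of_condition2`, `phaseErrorBound_of_bounds`);
* §4 (append): `contDiff_field`, `contDiff_V`, `fderiv_V_field`, **`exists_isSolutionOn`** — from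
  EVERY initial state a solution of (17) on `[0, ∞)` exists (the statements above are not vacuous);
* §5 (append): `logisticAmp` (closed-form solution of the logistic amplitude equation on `𝒮`),
  `hasDerivAt_logisticAmp`, `isSolutionOn_logisticRay`, `tendsto_logisticAmp`, **`origin_unstable`**
  — the origin is an UNSTABLE equilibrium of (17), witnessed by explicit escaping solutions on `𝒮`
  ([ColombinoEtAl2019, Prop. 8]'s «v̄ = 0 is unstable»; the exponential rate is the tree's
  `ray_exp_growth`);
* §6 (append): `isSolutionOn_unique`, `existsUnique_isSolutionOn` — from every initial state EXACTLY
  ONE solution of (17) on `[0, ∞)`;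
* §7 (append): `eq_logisticRay_of_embS`, `tendsto_of_embS` — a solution issued from `S(a,b) ≠ 0` IS
  the logistic ray and converges to `r⁻¹S(a,b) ∈ 𝒮 ∩ 𝒜` («𝒮 ∖ {0} is invariant»: on `𝒮` only the
  rest solution tends to `0`);
* §8 (append): `core_of_proposition2`, **`prop2_dichotomy`**, `prop2_tendsto_infDist_target_of_V_lt`,
  `prop2_target_stable`, `prop2_existsUnique_isSolutionOn` — the conclusions of §§3–6 under
  PROPOSITION 2'S PRINTED POWER-FLOW HYPOTHESES (branch powers `p_jk*`, `q_jk*`, set-point bounds,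
  `|θ_jk*| ≤ π/2`, `‖K_k‖ ≤ κ_K`, `Σ_j‖Y_jk‖ ≤ d`, one variational `λ ≤ λ₂(L)` certificate;
  `κ₀ = κ_K + 2d`): no operator norm left;
* §9 (append): `field_eq_zero_of_mem_target`, `field_zero`, **`field_eq_zero_iff`** — the rest points
  of (17) are EXACTLY `(𝒮 ∩ 𝒜) ∪ {0}` (corollary of the dichotomy);
* §10 (append): `tendsto_nsq_of_tendsto_infDist_target`, **`objectives_or_tendsto_zero`** — the
  dichotomy in the words of §II-C: every solution tends to `0` or achieves voltage regulation
  `‖v_k‖² → v_k*²` and phase synchronisation `‖v‖²_S → 0`.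

## Not here (deliberately)

The measure-zero clause for the region of attraction of the origin ([ColombinoEtAl2019, Prop. 8]:
stable-manifold theorem; the tree's `hasFDerivAt_field_zero` / `jac0_embS` give the unstable
directions); existence of solutions was first typed on the Summits side
(`DvocReducedRoa.exists_isSolutionOn`) and is re-proved here in §4 (Literature cannot import Summits).
-/

noncomputable section

namespace Literature.MathematicalPhysics.PowerSystems

open Real Finset Set Filter Metric
open scoped _root_.Topology
open Literature.Analysis.ODE

namespace DvocReduced

variable {N : ℕ} (W : DvocReduced N)

/-! ## §1 Regularity, the target set, compact sublevel sets -/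

/-- The reduced-order field (17) is continuous (polynomial) (Summits-side twin:
`Summit.Ventures.GridStability.Lyapunov.DvocReducedRoa.continuous_field`). [cite: GrossEtAl2019, eq. (17)] -/
theorem continuous_field : Continuous W.field := by
  unfold field g₁ g₂ eθ₁ eθ₂ Phi dvocNsq; fun_prop

/-- The target set `𝒯 = 𝒮 ∩ 𝒜 = {v ∈ 𝒮 | ‖v_k‖ = v_k* ∀k}` of the reduced-order model, as a subset of
`ℝ^{2N}`. [cite: GrossEtAl2019, §IV-D («V = 0 for all v ∈ 𝒮 ∩ 𝒜»)] -/
def target : Set (DvocState N) := {v | W.InS v ∧ ∀ k, dvocNsq v k = W.vref k ^ 2}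

/-- `𝒮 ∩ 𝒜` is the image of the unit circle under the `S`-matrix embedding (`v_k* ≠ 0`, `N ≥ 1`).
[cite: GrossEtAl2019, §IV-D] -/
theorem target_eq_image [NeZero N] (hv : ∀ k, W.vref k ≠ 0) :
    W.target = (fun p : ℝ × ℝ => W.embS p.1 p.2) '' {p : ℝ × ℝ | p.1 ^ 2 + p.2 ^ 2 = 1} := by
  ext v
  constructor
  · rintro ⟨⟨a, b, hab⟩, hA⟩
    refine ⟨(a, b), ?_, hab.symm⟩
    have h0 := hA (0 : Fin N)
    rw [hab, W.nsq_embS] at h0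
    have hv0 : W.vref 0 ^ 2 ≠ 0 := pow_ne_zero 2 (hv 0)
    show a ^ 2 + b ^ 2 = 1
    have : W.vref 0 ^ 2 * (a ^ 2 + b ^ 2 - 1) = 0 := by linarith
    rcases mul_eq_zero.1 this with h | h
    · exact absurd h hv0
    · linarith
  · rintro ⟨p, hp, rfl⟩
    have hp' : p.1 ^ 2 + p.2 ^ 2 = 1 := hp
    refine ⟨⟨p.1, p.2, rfl⟩, fun k => ?_⟩
    rw [W.nsq_embS, hp', mul_one]

/-- **`𝒮 ∩ 𝒜` is compact** («𝒮 ∩ 𝒜 is a compact set»). [cite: GrossEtAl2019, proof of Prop. 3] -/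
theorem isCompact_target [NeZero N] (hv : ∀ k, W.vref k ≠ 0) : IsCompact W.target := by
  rw [W.target_eq_image hv]
  refine IsCompact.image ?_ (by unfold embS; fun_prop)
  refine Metric.isCompact_of_isClosed_isBounded (isClosed_eq (by fun_prop) continuous_const) ?_
  refine (Metric.isBounded_closedBall (x := (0 : ℝ × ℝ)) (r := 1)).subset fun p hp => ?_
  have hp' : p.1 ^ 2 + p.2 ^ 2 = 1 := hp
  rw [mem_closedBall, dist_zero_right, Prod.norm_def, max_le_iff, Real.norm_eq_abs,
    Real.norm_eq_abs]
  constructor <;> nlinarith [sq_nonneg p.1, sq_nonneg p.2, abs_nonneg p.1, abs_nonneg p.2,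
    sq_abs p.1, sq_abs p.2]

/-- **Every sublevel set `{V ≤ c}` of (19) is compact** (`ηαα₁ > 0`, `v_k* > 0`): closed by
continuity, bounded because the penalty term confines every `‖v_k‖` (tree `nsq_le_of_V_le`) — the
`𝒦∞` lower bound (24) «radially unbounded with respect to 𝒮 ∩ 𝒜» (Summits-side twin:
`…DvocReducedRoa.isCompact_sublevel`). [cite: GrossEtAl2019, Prop. 3 (24)] -/
theorem isCompact_V_sublevel [NeZero N] (hv : ∀ k, 0 < W.vref k) {α₁ : ℝ}
    (hw : 0 < W.η * W.α * α₁) (c : ℝ) : IsCompact {v : DvocState N | W.V α₁ v ≤ c} := by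
  have hΛ : W.Lam ≠ 0 := (W.Lam_pos hv).ne'
  set s : ℝ := Real.sqrt (2 * c / (W.η * W.α * α₁)) with hs
  set B : ℝ := ∑ j, (W.vref j ^ 2 + s * |W.vref j|) with hB
  refine Metric.isCompact_of_isClosed_isBounded (isClosed_le (W.continuous_V α₁) continuous_const) ?_
  refine (Metric.isBounded_closedBall (x := (0 : DvocState N)) (r := Real.sqrt B)).subset
    fun v hv' => ?_
  have hc : W.V α₁ v ≤ c := hv'
  have hk : ∀ k, dvocNsq v k ≤ B := fun k =>
    (W.nsq_le_of_V_le hΛ hw hc (hv k).ne').trans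
      (Finset.single_le_sum (f := fun j => W.vref j ^ 2 + s * |W.vref j|)
        (fun j _ => by positivity) (Finset.mem_univ k))
  have h1 : ∀ k, |v.1 k| ≤ Real.sqrt B := fun k =>
    Real.abs_le_sqrt (by have := hk k; unfold dvocNsq at this; nlinarith [sq_nonneg (v.2 k)])
  have h2 : ∀ k, |v.2 k| ≤ Real.sqrt B := fun k =>
    Real.abs_le_sqrt (by have := hk k; unfold dvocNsq at this; nlinarith [sq_nonneg (v.1 k)])
  have hR : 0 ≤ Real.sqrt B := Real.sqrt_nonneg _
  rw [mem_closedBall, dist_zero_right, Prod.norm_def, max_le_iff, pi_norm_le_iff_of_nonneg hR,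
    pi_norm_le_iff_of_nonneg hR]
  exact ⟨fun k => by rw [Real.norm_eq_abs]; exact h1 k, fun k => by rw [Real.norm_eq_abs]; exact h2 k⟩

/-! ## §2 A solution of (17) is a dissipative curve for `V` with rate `α₁ψ²` -/

/-- **A solution of (17) on `[0, ∞)` is a `DissipativeCurve`** for `V` (19) with the rate `α₁ψ(v)²`
of Prop. 3 (25), inside its own sublevel set `{V ≤ V(v(0))}` (hypotheses of the tree's Prop. 3).
[cite: GrossEtAl2019, Prop. 3 (25)] -/
theorem dissipativeCurve [NeZero N] (hη : 0 < W.η) (hα : 0 ≤ W.α) (hv : ∀ k, 0 < W.vref k)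
    {c κ₀ : ℝ} (hc : 0 < c) (hκ₀ : 0 < κ₀) (h23 : W.DecreaseOnS c) (hK : W.PhaseErrorBound κ₀)
    {γ : ℝ → DvocState N} (hsol : W.IsSolutionOn γ (Ici 0)) :
    DissipativeCurve W.field (W.V (W.alpha1 c κ₀))
      (fun v => W.alpha1 c κ₀ * W.psi κ₀ v ^ 2) {v | W.V (W.alpha1 c κ₀) v ≤ W.V (W.alpha1 c κ₀) (γ 0)} γ := by
  -- first without the confinement, to get monotonicity of `V` from the general lemma
  have h₀ : DissipativeCurve W.field (W.V (W.alpha1 c κ₀))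
      (fun v => W.alpha1 c κ₀ * W.psi κ₀ v ^ 2) univ γ :=
    { hasDeriv := fun t ht => hsol t (mem_Ici.2 ht)
      lyapunov := fun t ht => by
        obtain ⟨d, hd, hle, -⟩ := W.hasDerivWithinAt_V_le hη hα hv hc hκ₀ h23 hK
          (hsol t (mem_Ici.2 ht))
        exact ⟨d, hd, by linarith⟩
      mapsTo := fun t _ => mem_univ _ }
  have hα₁ : 0 ≤ W.alpha1 c κ₀ := by unfold alpha1; positivity
  exact { hasDeriv := h₀.hasDeriv, lyapunov := h₀.lyapunov,
          mapsTo := fun t ht => h₀.apply_le_apply (fun y _ => by positivity) le_rfl ht }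

/-! ## §3 The conclusions of [GrossEtAl2019, Thm. 1] for the reduced-order model (17) -/

/-- **THE DICHOTOMY for the reduced-order dVOC model**
[cite: GrossEtAl2019, Prop. 3 with Thm. 1 (𝒞 = 𝒮 ∩ 𝒜, 𝒰 = {0})]: for `N ≥ 1` converters, gains
`η, α > 0`, set-points `v_k* > 0`, a margin
`c > 0` with (23) and a phase-error bound `κ₀ > 0`, EVERY solution `v(t)` of (17) on `[0, ∞)`
satisfies `dist(v(t), 𝒮 ∩ 𝒜) → 0` OR `v(t) → 0` — every initial state outside the region of attraction
of the origin synchronises in phase and magnitude (print: «almost globally», with a measure-zero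
clause that is not formalized). MODELLED: reduced model (17); nothing here is a grid. -/
theorem tendsto_infDist_target_or_tendsto_zero [NeZero N] (hη : 0 < W.η) (hα : 0 < W.α)
    (hv : ∀ k, 0 < W.vref k) {c κ₀ : ℝ} (hc : 0 < c) (hκ₀ : 0 < κ₀) (h23 : W.DecreaseOnS c)
    (hK : W.PhaseErrorBound κ₀) {γ : ℝ → DvocState N} (hsol : W.IsSolutionOn γ (Ici 0)) :
    Tendsto (fun t => infDist (γ t) W.target) atTop (𝓝 0) ∨ Tendsto γ atTop (𝓝 0) := by
  have hΛ : W.Lam ≠ 0 := (W.Lam_pos hv).ne'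
  have hv' : ∀ k, W.vref k ≠ 0 := fun k => (hv k).ne'
  have hα₁ : 0 < W.alpha1 c κ₀ := by unfold alpha1; positivity
  have hw : 0 < W.η * W.α * W.alpha1 c κ₀ := by positivity
  have hcurve := W.dissipativeCurve hη hα.le hv hc hκ₀ h23 hK hsol
  have hres := hcurve.tendsto_infDist_or_of_disjoint (W.isCompact_V_sublevel hv hw _)
    W.continuous_field.continuousOn (W.continuous_V _).continuousOn
    (by have := W.continuous_psi κ₀; fun_prop : Continuous fun v : DvocState N =>
      W.alpha1 c κ₀ * W.psi κ₀ v ^ 2).continuousOn (fun y _ => by positivity)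
    (U := {(0 : DvocState N)}) (W.isCompact_target hv') isCompact_singleton ?_
    (fun y _ => W.V_nonneg hΛ hw.le y) (fun y _ => W.V_eq_zero_iff hΛ hw hv' y) ?_
  · rcases hres.1 with hT | h0
    · exact Or.inl hT
    · right
      rw [tendsto_iff_dist_tendsto_zero]
      simpa [infDist_singleton] using h0
  · -- `𝒮 ∩ 𝒜` misses the origin
    rw [Set.disjoint_singleton_right]
    rintro ⟨-, hA⟩
    have h0 := hA (0 : Fin N)
    simp only [dvocNsq, Prod.fst_zero, Prod.snd_zero, Pi.zero_apply] at h0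
    have : 0 < W.vref 0 ^ 2 := by have := hv 0; positivity
    nlinarith
  · -- zero set of the rate = `𝒯 ∪ {0}`
    rintro y ⟨-, hy⟩
    have hψ : W.psi κ₀ y = 0 := by
      rcases mul_eq_zero.1 hy with h | h
      · exact absurd h hα₁.ne'
      · exact (pow_eq_zero_iff two_ne_zero).1 h
    rcases (W.psi_eq_zero_iff hη hα hκ₀ hv y).1 hψ with hT | h0
    · exact Or.inl hT
    · exact Or.inr h0

/-- **The explicit region of attraction** [cite: GrossEtAl2019, Prop. 3 with Thm. 1]: every solution of
(17) on `[0, ∞)` with `V(v(0)) < V(0) = ½ηαα₁Σ_k v_k*²` has `dist(v(t), 𝒮 ∩ 𝒜) → 0` (the origin —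
the print's measure-zero exception — sits exactly at the excluded level). MODELLED: reduced model (17). -/
theorem tendsto_infDist_target_of_V_lt [NeZero N] (hη : 0 < W.η) (hα : 0 < W.α)
    (hv : ∀ k, 0 < W.vref k) {c κ₀ : ℝ} (hc : 0 < c) (hκ₀ : 0 < κ₀) (h23 : W.DecreaseOnS c)
    (hK : W.PhaseErrorBound κ₀) {γ : ℝ → DvocState N} (hsol : W.IsSolutionOn γ (Ici 0))
    (hlt : W.V (W.alpha1 c κ₀) (γ 0) < W.V (W.alpha1 c κ₀) 0) :
    Tendsto (fun t => infDist (γ t) W.target) atTop (𝓝 0) := by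
  have hα₁ : 0 < W.alpha1 c κ₀ := by unfold alpha1; positivity
  have hw : 0 < W.η * W.α * W.alpha1 c κ₀ := by positivity
  have hcurve := W.dissipativeCurve hη hα.le hv hc hκ₀ h23 hK hsol
  refine hcurve.tendsto_infDist_of_apply_lt (W.isCompact_V_sublevel hv hw _)
    W.continuous_field.continuousOn (W.continuous_V _).continuousOn
    (by have := W.continuous_psi κ₀; fun_prop : Continuous fun v : DvocState N =>
      W.alpha1 c κ₀ * W.psi κ₀ v ^ 2).continuousOn (fun y _ => by positivity)
    (B := {(0 : DvocState N)}) isClosed_singleton ?_ (b := W.V (W.alpha1 c κ₀) 0) ?_ le_rfl hlt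
  · rintro y ⟨-, hy⟩
    have hψ : W.psi κ₀ y = 0 := by
      rcases mul_eq_zero.1 hy with h | h
      · exact absurd h hα₁.ne'
      · exact (pow_eq_zero_iff two_ne_zero).1 h
    rcases (W.psi_eq_zero_iff hη hα hκ₀ hv y).1 hψ with hT | h0
    · exact Or.inl hT
    · exact Or.inr h0
  · rintro y ⟨hy, -⟩
    rw [Set.mem_singleton_iff.1 hy]

/-- **`𝒮 ∩ 𝒜` is Lyapunov stable for (17)**, uniformly over solutions
[cite: GrossEtAl2019, Prop. 3 (24) with Thm. 1]: for every `ε > 0` there is `δ > 0` such that every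
solution of (17) on `[0, ∞)`
starting within `δ` of `𝒮 ∩ 𝒜` stays within `ε` of it. MODELLED: reduced model (17). -/
theorem target_stable [NeZero N] (hη : 0 < W.η) (hα : 0 < W.α) (hv : ∀ k, 0 < W.vref k)
    {c κ₀ : ℝ} (hc : 0 < c) (hκ₀ : 0 < κ₀) (h23 : W.DecreaseOnS c) (hK : W.PhaseErrorBound κ₀)
    {ε : ℝ} (hε : 0 < ε) :
    ∃ δ > 0, ∀ γ : ℝ → DvocState N, W.IsSolutionOn γ (Ici 0) →
      infDist (γ 0) W.target < δ → ∀ t, 0 ≤ t → infDist (γ t) W.target < ε := by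
  have hΛ : W.Lam ≠ 0 := (W.Lam_pos hv).ne'
  have hv' : ∀ k, W.vref k ≠ 0 := fun k => (hv k).ne'
  have hα₁ : 0 < W.alpha1 c κ₀ := by unfold alpha1; positivity
  have hw : 0 < W.η * W.α * W.alpha1 c κ₀ := by positivity
  obtain ⟨δ, hδ, hst⟩ := exists_forall_infDist_lt (W.continuous_V (W.alpha1 c κ₀))
    (fun y => W.V_nonneg hΛ hw.le y) (fun y => W.V_eq_zero_iff hΛ hw hv' y)
    (W.isCompact_target hv') one_pos (W.isCompact_V_sublevel hv hw 1) hε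
  refine ⟨δ, hδ, fun γ hsol h0 t ht => hst γ (fun s hs => ?_) h0 t ht⟩
  exact (W.dissipativeCurve hη hα.le hv hc hκ₀ h23 hK hsol).mapsTo s hs

/-- **The dichotomy and the region of attraction under Condition 2's first inequality AS PRINTED**
[cite: GrossEtAl2019, Condition 2 / Prop. 3 with Thm. 1]: `N ≥ 1` converters with symmetric
nonnegative edge weights, gains `η, α > 0`, set-points `v_k* > 0`, a margin `c > 0`, a certified
algebraic-connectivity bound `λ ≤ λ₂(L)` (variational form), a steady-state angle bound `θ̄ ∈ [0, π]`,
bounds `v_min ≤ v_k* ≤ v_max`, the node form of Condition 2's first inequality, and bounds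
`‖K_k‖ ≤ κ_K`, `Σ_j‖Y_jk‖ ≤ d` (so `‖𝒦 − 𝓛‖ ≤ κ_K + 2d`). MODELLED: reduced model (17). -/
theorem tendsto_infDist_target_of_condition2 [NeZero N] (hsym : ∀ k j, W.w k j = W.w j k)
    (hw : ∀ k j, 0 ≤ W.w k j) (hη : 0 < W.η) (hα : 0 < W.α) (hv : ∀ k, 0 < W.vref k)
    {lam c θbar vmin vmax κK d : ℝ} (hc : 0 < c)
    (hlam : ∀ z : Fin N → ℝ,
      lam * pairNormSq z ≤ N * (1 / 2 * ∑ i, ∑ j, W.w i j * (z i - z j) ^ 2))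
    (hθ0 : 0 ≤ θbar) (hθπ : θbar ≤ π) (hang : ∀ j k, |W.θ j - W.θ k| ≤ θbar)
    (hvmin : 0 < vmin) (hmin : ∀ k, vmin ≤ W.vref k) (hmax : ∀ k, W.vref k ≤ vmax)
    (hcond : ∀ k,
      W.nodeGainAbs k + W.α < (1 + cos θbar) / 2 * (vmin ^ 2 / vmax ^ 2) * lam - c)
    (hκK : 0 < κK) (hKk : ∀ k, W.nodeGain k ^ 2 + W.nodeRot k ^ 2 ≤ κK ^ 2)
    (hd : ∀ k, ∑ j, W.w k j ≤ d)
    {γ : ℝ → DvocState N} (hsol : W.IsSolutionOn γ (Ici 0)) :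
    (Tendsto (fun t => infDist (γ t) W.target) atTop (𝓝 0) ∨ Tendsto γ atTop (𝓝 0)) ∧
    (W.V (W.alpha1 c (κK + 2 * d)) (γ 0) < W.V (W.alpha1 c (κK + 2 * d)) 0 →
      Tendsto (fun t => infDist (γ t) W.target) atTop (𝓝 0)) := by
  have k0 : Fin N := ⟨0, Nat.pos_of_ne_zero (NeZero.ne N)⟩
  have hd0 : 0 ≤ d := (Finset.sum_nonneg fun j _ => hw k0 j).trans (hd k0)
  have hκ₀ : 0 < κK + 2 * d := by positivity
  have h23 := W.decreaseOnS_of_condition2 hsym hw hv hα.le hc.le hlam hθ0 hθπ hang hvmin hmin hmax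
    hcond
  have hK := W.phaseErrorBound_of_bounds hsym hw hv hκK.le hKk hd
  exact ⟨W.tendsto_infDist_target_or_tendsto_zero hη hα hv hc hκ₀ h23 hK hsol,
    fun hlt => W.tendsto_infDist_target_of_V_lt hη hα hv hc hκ₀ h23 hK hsol hlt⟩

/-! ## §4 Solutions of (17) exist on `[0, ∞)` from every initial state (append 2026-08-27, same source)

The field (17) is polynomial (hence `C¹`), `V` is `C¹` with `DV(v)·f(v) = V̇(v) ≤ 0` (Prop. 3), and every
sublevel set of `V` is compact, so the tree's `Literature.Analysis.ODE.exists_global_solution_of_sublevel`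
yields a solution on `[0, ∞)` from every initial state — the «EVERY solution» statements of §3 are not
vacuous. (Summits-side twins by lyap-1: `DvocReducedRoa.contDiff_field/contDiff_V/fderiv_V_field/
exists_isSolutionOn`, not importable into Literature.) -/

/-- The reduced-order field (17) is `C¹` (polynomial). [cite: GrossEtAl2019, eq. (17)] -/
theorem contDiff_field : ContDiff ℝ 1 W.field := by
  unfold field g₁ g₂ eθ₁ eθ₂ Phi dvocNsq; fun_prop

/-- The Lyapunov function `V` (19) is `C¹` (polynomial). [cite: GrossEtAl2019, eq. (19)] -/
theorem contDiff_V (α₁ : ℝ) : ContDiff ℝ 1 (W.V α₁) := by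
  unfold V normS2 qS sig₁ sig₂ dvocDot dvocNsq; fun_prop

/-- **The Fréchet derivative of (19) along (17) is the printed (26)**: `DV(v)·f(v) = Vdot v` (the tree's
chain rule `hasDerivWithinAt_V` along the straight line `v + τ f(v)`, uniqueness of derivatives).
[cite: GrossEtAl2019, eq. (26)] -/
theorem fderiv_V_field (α₁ : ℝ) (x : DvocState N) :
    fderiv ℝ (W.V α₁) x (W.field x) = W.Vdot α₁ x := by
  set γ : ℝ → DvocState N := fun τ => x + τ • W.field x with hγdef
  have hγ0 : γ 0 = x := by simp [hγdef]
  have hγ : HasDerivAt γ (W.field x) 0 := by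
    have h := ((hasDerivAt_id (0 : ℝ)).smul_const (W.field x)).const_add x
    simpa [hγdef] using h
  have hVx : HasFDerivAt (W.V α₁) (fderiv ℝ (W.V α₁) x) (γ 0) := by
    rw [hγ0]; exact ((W.contDiff_V α₁).differentiable one_ne_zero x).hasFDerivAt
  have h1 : HasDerivAt (fun τ => W.V α₁ (γ τ)) (fderiv ℝ (W.V α₁) x (W.field x)) 0 :=
    hVx.comp_hasDerivAt 0 hγ
  have h2 : HasDerivAt (fun τ => W.V α₁ (γ τ)) (W.Vdot α₁ (γ 0)) 0 := by
    have h' := W.hasDerivWithinAt_V α₁ (s := univ) (t := 0) (γ := γ)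
      (by rw [hγ0]; exact hγ.hasDerivWithinAt)
    exact hasDerivWithinAt_univ.1 h'
  rw [hγ0] at h2
  exact h1.unique h2

/-- **From every initial state a solution of (17) on `[0, ∞)` exists** (hypotheses of the tree's
Prop. 3 with `α > 0`): `f ∈ C¹`, `DV·f ≤ 0` everywhere (Prop. 3), compact sublevel sets of `V`;
continuation by the tree's `exists_global_solution_of_sublevel`, then within-`Icc 0 T` to within-`Ici 0`.
[cite: GrossEtAl2019, Prop. 3] -/
theorem exists_isSolutionOn [NeZero N] (hη : 0 < W.η) (hα : 0 < W.α) (hv : ∀ k, 0 < W.vref k)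
    {c κ₀ : ℝ} (hc : 0 < c) (hκ₀ : 0 < κ₀) (h23 : W.DecreaseOnS c) (hK : W.PhaseErrorBound κ₀)
    (x₀ : DvocState N) : ∃ γ : ℝ → DvocState N, γ 0 = x₀ ∧ W.IsSolutionOn γ (Ici 0) := by
  have hα₁ : 0 < W.alpha1 c κ₀ := by unfold alpha1; positivity
  have hw : 0 < W.η * W.α * W.alpha1 c κ₀ := by positivity
  set U := W.V (W.alpha1 c κ₀) with hU
  have hS : IsCompact {x : DvocState N | x ∈ (univ : Set _) ∩ univ ∧ U x ≤ U x₀} := by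
    have := W.isCompact_V_sublevel hv hw (U x₀)
    simpa using this
  obtain ⟨X, hX0, hX⟩ := exists_global_solution_of_sublevel (F := W.field) (V := U)
    (V' := fun x => fderiv ℝ U x) (G := univ) (M := univ) (c := U x₀) isOpen_univ
    (fun x _ => ((W.contDiff_V _).differentiable one_ne_zero x).hasFDerivAt)
    (fun x _ => by
      show fderiv ℝ U x (W.field x) ≤ 0
      rw [hU, W.fderiv_V_field]
      have h := W.Vdot_le_neg_alpha1_psi_sq hη hα.le hv hc hκ₀ h23 hK x
      nlinarith [sq_nonneg (W.psi κ₀ x)])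
    hS W.contDiff_field (x₀ := x₀) ⟨⟨mem_univ _, mem_univ _⟩, le_rfl⟩
    (fun _ _ _ _ _ _ => mem_univ _)
  refine ⟨X, hX0, fun t ht => ?_⟩
  have ht0 : 0 ≤ t := ht
  have h1 := hX (t + 1) t ⟨ht0, by linarith⟩
  refine h1.mono_of_mem_nhdsWithin ?_
  have hIio : Iio (t + 1) ∈ 𝓝 t := Iio_mem_nhds (by linarith)
  exact mem_of_superset (inter_mem_nhdsWithin (Ici (0 : ℝ)) hIio) fun s hs => ⟨hs.1, hs.2.le⟩

/-! ## §5 The origin of (17) is an unstable equilibrium: explicit escaping solutions on `𝒮`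
(append 2026-08-27, same sources)

[ColombinoEtAl2019, Prop. 8] «the equilibrium v̄ = 0 is unstable»; [GrossEtAl2019, Thm. 2] «the origin
0ₙ is an exponentially unstable equilibrium» (for (17): the dynamics on `𝒮` are the scalar logistic
equation `ρ̇ = ηα(1 − r²ρ²)ρ`, tree `isSolutionOn_ray`, with the exponential rate of `ray_exp_growth`).
Here the logistic equation is SOLVED in closed form, `ρ(t) = (r² + (ρ₀⁻² − r²)e^{−2ηαt})^{−1/2}`, which
gives, for every `ρ₀ > 0`, a solution `t ↦ ρ(t)·S(a,b)` of (17) on `[0, ∞)` issued from `ρ₀·S(a,b)`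
(arbitrarily close to `0`) whose amplitude tends to `1/r`: the origin is unstable in Lyapunov's sense
(`origin_unstable`), and the alternative «v(t) → 0» of the dichotomy is realised only by the rest
solution among the solutions on `𝒮`. -/

/-- The closed-form logistic amplitude `ρ(t) = (r² + (ρ₀⁻² − r²) e^{−2ηα t})^{−1/2}` solving
`ρ̇ = ηα(1 − r²ρ²)ρ`, `ρ(0) = ρ₀ > 0` (`r² = a² + b²` the squared normalised amplitude of `S(a,b)`).
[cite: ColombinoEtAl2019, proof of Prop. 10 (dynamics on 𝒮)] -/
def logisticAmp (r2 ρ₀ t : ℝ) : ℝ :=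
  (Real.sqrt (r2 + (ρ₀⁻¹ ^ 2 - r2) * Real.exp (-(2 * W.η * W.α) * t)))⁻¹

/-- The quantity under the root is positive for `t ≥ 0` (`ηα ≥ 0`, `r² ≥ 0`, `ρ₀ > 0`): it is the
combination `r²(1 − e) + ρ₀⁻² e` with `e = e^{−2ηαt} ∈ (0, 1]`. [folklore] -/
private theorem logistic_base_pos (hη : 0 ≤ W.η) (hα : 0 ≤ W.α) {r2 ρ₀ : ℝ} (hr : 0 ≤ r2)
    (hρ₀ : 0 < ρ₀) {t : ℝ} (ht : 0 ≤ t) :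
    0 < r2 + (ρ₀⁻¹ ^ 2 - r2) * Real.exp (-(2 * W.η * W.α) * t) := by
  set e := Real.exp (-(2 * W.η * W.α) * t) with he
  have he0 : 0 < e := Real.exp_pos _
  have he1 : e ≤ 1 := by
    rw [he, Real.exp_le_one_iff]
    have : 0 ≤ 2 * W.η * W.α * t := by positivity
    linarith
  have hρ : 0 < ρ₀⁻¹ ^ 2 := by positivity
  nlinarith

/-- `ρ(0) = ρ₀`. [cite: ColombinoEtAl2019, proof of Prop. 10] -/
theorem logisticAmp_zero (r2 : ℝ) {ρ₀ : ℝ} (hρ₀ : 0 < ρ₀) : W.logisticAmp r2 ρ₀ 0 = ρ₀ := by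
  simp only [logisticAmp, mul_zero, Real.exp_zero, mul_one, add_sub_cancel]
  rw [Real.sqrt_sq (inv_pos.2 hρ₀).le, inv_inv]

/-- `ρ(t) > 0` for `t ≥ 0`. [cite: ColombinoEtAl2019, proof of Prop. 10] -/
theorem logisticAmp_pos (hη : 0 ≤ W.η) (hα : 0 ≤ W.α) {r2 ρ₀ : ℝ} (hr : 0 ≤ r2) (hρ₀ : 0 < ρ₀)
    {t : ℝ} (ht : 0 ≤ t) : 0 < W.logisticAmp r2 ρ₀ t :=
  inv_pos.2 (Real.sqrt_pos.2 (W.logistic_base_pos hη hα hr hρ₀ ht))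

/-- **The closed form solves the logistic equation**: `ρ̇(t) = ηα(1 − r²ρ(t)²)ρ(t)` at every `t ≥ 0`.
[cite: ColombinoEtAl2019, proof of Prop. 10 (dynamics on 𝒮)] -/
theorem hasDerivAt_logisticAmp (hη : 0 ≤ W.η) (hα : 0 ≤ W.α) {r2 ρ₀ : ℝ} (hr : 0 ≤ r2)
    (hρ₀ : 0 < ρ₀) {t : ℝ} (ht : 0 ≤ t) :
    HasDerivAt (W.logisticAmp r2 ρ₀)
      (W.η * W.α * (1 - r2 * W.logisticAmp r2 ρ₀ t ^ 2) * W.logisticAmp r2 ρ₀ t) t := by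
  set c : ℝ := 2 * W.η * W.α with hc
  set A : ℝ := ρ₀⁻¹ ^ 2 - r2 with hA
  set u : ℝ → ℝ := fun τ => r2 + A * Real.exp (-c * τ) with hu
  have hut : 0 < u t := W.logistic_base_pos hη hα hr hρ₀ ht
  have hsq : 0 < Real.sqrt (u t) := Real.sqrt_pos.2 hut
  -- derivative of `u`
  have hdu : HasDerivAt u (A * (Real.exp (-c * t) * (-c * 1))) t := by
    have h := (((hasDerivAt_id t).const_mul (-c)).exp).const_mul A
    have h' := h.const_add r2
    simpa [hu] using h'
  -- derivative of `(√u)⁻¹`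
  have hds := (hdu.sqrt hut.ne').inv hsq.ne'
  have hfun : (fun τ => Real.sqrt (u τ))⁻¹ = W.logisticAmp r2 ρ₀ := by
    funext τ; simp [logisticAmp, hu, hA, hc]
  rw [hfun] at hds
  refine hds.congr_deriv ?_
  -- algebra: `-(u'/(2√u))/(√u)² = ηα(1 − r²/u)/√u`
  have hρt : W.logisticAmp r2 ρ₀ t = (Real.sqrt (u t))⁻¹ := by simp [logisticAmp, hu, hA, hc]
  have hss : Real.sqrt (u t) ^ 2 = u t := Real.sq_sqrt hut.le
  have hAe : A * Real.exp (-c * t) = u t - r2 := by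
    show A * Real.exp (-c * t) = (r2 + A * Real.exp (-c * t)) - r2
    ring
  rw [hρt]
  set S := Real.sqrt (u t) with hS
  have hS0 : S ≠ 0 := hsq.ne'
  have key : A * (Real.exp (-c * t) * (-c * 1)) = -c * (S ^ 2 - r2) := by
    rw [hss, ← hAe]; ring
  rw [key, hc]
  field_simp

/-- **The escaping solutions**: for every `ρ₀ > 0` and every `(a, b)`, `t ↦ ρ(t) · S(a,b)` with the
closed-form amplitude `ρ` (`r² = a² + b²`) solves (17) on `[0, ∞)` (all `v_k* ≠ 0`, `η, α ≥ 0`).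
[cite: ColombinoEtAl2019, proof of Prop. 10 («𝒮 ∖ {0} is invariant»); GrossEtAl2019, eq. (17)] -/
theorem isSolutionOn_logisticRay (hv : ∀ k, W.vref k ≠ 0) (hη : 0 ≤ W.η) (hα : 0 ≤ W.α) (a b : ℝ)
    {ρ₀ : ℝ} (hρ₀ : 0 < ρ₀) :
    W.IsSolutionOn (fun t => W.logisticAmp (a ^ 2 + b ^ 2) ρ₀ t • W.embS a b) (Ici 0) := by
  refine W.isSolutionOn_ray hv a b fun t ht => ?_
  exact (W.hasDerivAt_logisticAmp hη hα (by positivity) hρ₀ ht).hasDerivWithinAt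

/-- **The amplitude tends to the nominal one**: `ρ(t) → 1/r` as `t → ∞` (`r² > 0`, `ηα > 0`), so the
escaping solutions converge to the point `r⁻¹S(a,b) ∈ 𝒮 ∩ 𝒜`. [cite: ColombinoEtAl2019, proof of
Prop. 10] -/
theorem tendsto_logisticAmp (hη : 0 < W.η) (hα : 0 < W.α) {r2 : ℝ} (hr : 0 < r2) (ρ₀ : ℝ) :
    Tendsto (W.logisticAmp r2 ρ₀) atTop (𝓝 (Real.sqrt r2)⁻¹) := by
  have hc : 0 < 2 * W.η * W.α := by positivity
  have he : Tendsto (fun t : ℝ => Real.exp (-(2 * W.η * W.α) * t)) atTop (𝓝 0) := by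
    have := Real.tendsto_exp_neg_atTop_nhds_zero.comp (tendsto_id.const_mul_atTop hc)
    refine this.congr fun t => ?_
    simp [neg_mul]
  have hu : Tendsto (fun t : ℝ => r2 + (ρ₀⁻¹ ^ 2 - r2) * Real.exp (-(2 * W.η * W.α) * t)) atTop
      (𝓝 r2) := by
    have := (he.const_mul (ρ₀⁻¹ ^ 2 - r2)).const_add r2
    simpa using this
  have hs := (hu.sqrt).inv₀ (Real.sqrt_pos.2 hr).ne'
  exact hs

/-- **The origin is an UNSTABLE equilibrium of (17)** (Lyapunov's sense) [cite: ColombinoEtAl2019,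
Prop. 8 («the equilibrium v̄ = 0 is unstable»); GrossEtAl2019, Thm. 2]: for `N ≥ 1`, `v_k* ≠ 0`,
`η, α > 0` there is `ε > 0` such that for every `δ > 0` some solution of (17) on `[0, ∞)` starts in
the `δ`-ball around `0` and reaches norm `≥ ε` — explicitly the ray solution `ρ(t)S(1,0)` with
`ρ₀ = δ/(2‖S(1,0)‖)`, whose norm tends to `‖S(1,0)‖ = 2ε`. MODELLED: reduced model (17). -/
theorem origin_unstable [NeZero N] (hv : ∀ k, W.vref k ≠ 0) (hη : 0 < W.η) (hα : 0 < W.α) :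
    ∃ ε > 0, ∀ δ > 0, ∃ γ : ℝ → DvocState N, W.IsSolutionOn γ (Ici 0) ∧ ‖γ 0‖ < δ ∧
      ∃ t, 0 ≤ t ∧ ε ≤ ‖γ t‖ := by
  set S₀ := W.embS 1 0 with hS₀
  have hS : S₀ ≠ 0 := by
    intro h0
    have h1 : dvocNsq S₀ (0 : Fin N) = W.vref 0 ^ 2 * (1 ^ 2 + 0 ^ 2) := W.nsq_embS 1 0 0
    rw [h0] at h1
    simp only [dvocNsq, Prod.fst_zero, Prod.snd_zero, Pi.zero_apply] at h1
    have : 0 < W.vref 0 ^ 2 := by have := hv 0; positivity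
    nlinarith
  have hSn : 0 < ‖S₀‖ := norm_pos_iff.2 hS
  refine ⟨‖S₀‖ / 2, by positivity, fun δ hδ => ?_⟩
  set ρ₀ : ℝ := δ / (2 * ‖S₀‖) with hρ₀
  have hρ₀pos : 0 < ρ₀ := by positivity
  refine ⟨fun t => W.logisticAmp (1 ^ 2 + 0 ^ 2) ρ₀ t • S₀, W.isSolutionOn_logisticRay hv hη.le hα.le
    1 0 hρ₀pos, ?_, ?_⟩
  · show ‖W.logisticAmp (1 ^ 2 + 0 ^ 2) ρ₀ 0 • S₀‖ < δ
    rw [W.logisticAmp_zero _ hρ₀pos, norm_smul, Real.norm_eq_abs, abs_of_pos hρ₀pos, hρ₀]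
    rw [div_mul_eq_mul_div, div_lt_iff₀ (by positivity)]
    nlinarith
  · have h12 : (1 : ℝ) ^ 2 + 0 ^ 2 = 1 := by norm_num
    have hlim : Tendsto (fun t => ‖W.logisticAmp (1 ^ 2 + 0 ^ 2) ρ₀ t • S₀‖) atTop (𝓝 ‖S₀‖) := by
      have h := ((W.tendsto_logisticAmp hη hα (by norm_num : (0 : ℝ) < 1 ^ 2 + 0 ^ 2)
        ρ₀).norm).mul_const ‖S₀‖
      rw [h12, Real.sqrt_one, inv_one, norm_one, one_mul] at h
      refine h.congr fun t => ?_
      rw [norm_smul, h12]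
    have hev : ∀ᶠ t in atTop, ‖S₀‖ / 2 < ‖W.logisticAmp (1 ^ 2 + 0 ^ 2) ρ₀ t • S₀‖ :=
      (tendsto_order.1 hlim).1 _ (by linarith)
    obtain ⟨t, ht⟩ := (hev.and (eventually_ge_atTop 0)).exists
    exact ⟨t, ht.2, ht.1.le⟩

/-! ## §6 Uniqueness: a solution of (17) on `[0, ∞)` is determined by its initial state
(append 2026-08-27, same sources)

With §4: from every initial state EXACTLY ONE solution of (17) on `[0, ∞)` (the field is `C¹`, hence
Lipschitz on the compact invariant sublevel set `{V ≤ V(v(0))}` — tree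
`Literature.Analysis.ODE.exists_lipschitzOnWith_of_isCompact` — and Grönwall's uniqueness
`ODE_solution_unique_of_mem_Icc_right` applies inside it). -/

/-- **Uniqueness of solutions of (17) on `[0, ∞)`** (hypotheses of the tree's Prop. 3 with `α > 0`):
two solutions with the same initial state coincide for all `t ≥ 0`. [cite: GrossEtAl2019, Prop. 3 /
Thm. 1 (the flow φ_f(t, x₀))] -/
theorem isSolutionOn_unique [NeZero N] (hη : 0 < W.η) (hα : 0 < W.α) (hv : ∀ k, 0 < W.vref k)
    {c κ₀ : ℝ} (hc : 0 < c) (hκ₀ : 0 < κ₀) (h23 : W.DecreaseOnS c) (hK : W.PhaseErrorBound κ₀)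
    {γ₁ γ₂ : ℝ → DvocState N} (h₁ : W.IsSolutionOn γ₁ (Ici 0)) (h₂ : W.IsSolutionOn γ₂ (Ici 0))
    (h0 : γ₁ 0 = γ₂ 0) {t : ℝ} (ht : 0 ≤ t) : γ₁ t = γ₂ t := by
  have hα₁ : 0 < W.alpha1 c κ₀ := by unfold alpha1; positivity
  have hw : 0 < W.η * W.α * W.alpha1 c κ₀ := by positivity
  have hc₁ := W.dissipativeCurve hη hα.le hv hc hκ₀ h23 hK h₁
  have hc₂ := W.dissipativeCurve hη hα.le hv hc hκ₀ h23 hK h₂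
  set K : Set (DvocState N) := {v | W.V (W.alpha1 c κ₀) v ≤ W.V (W.alpha1 c κ₀) (γ₁ 0)} with hKdef
  have hKc : IsCompact K := W.isCompact_V_sublevel hv hw _
  obtain ⟨L, hL⟩ := exists_lipschitzOnWith_of_isCompact isOpen_univ
    W.contDiff_field.contDiffOn hKc (subset_univ _)
  have heq := ODE_solution_unique_of_mem_Icc_right (v := fun _ => W.field) (s := fun _ => K)
    (K := L) (f := γ₁) (g := γ₂) (a := 0) (b := t) (fun _ _ => hL)
    (fun τ hτ => ((h₁ τ hτ.1).continuousWithinAt).mono Icc_subset_Ici_self)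
    (fun τ hτ => (h₁ τ hτ.1).mono (Ici_subset_Ici.2 hτ.1))
    (fun τ hτ => hc₁.mapsTo τ hτ.1)
    (fun τ hτ => ((h₂ τ hτ.1).continuousWithinAt).mono Icc_subset_Ici_self)
    (fun τ hτ => (h₂ τ hτ.1).mono (Ici_subset_Ici.2 hτ.1))
    (fun τ hτ => by
      have := hc₂.mapsTo τ hτ.1
      show W.V (W.alpha1 c κ₀) (γ₂ τ) ≤ W.V (W.alpha1 c κ₀) (γ₁ 0)
      rw [h0]; exact this)
    h0
  exact heq ⟨ht, le_rfl⟩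

/-- **Well-posedness of (17) on `[0, ∞)`**: from every initial state there is EXACTLY ONE solution
(existence §4, uniqueness above). [cite: GrossEtAl2019, Prop. 3 / Thm. 1 (the flow φ_f(t, x₀))] -/
theorem existsUnique_isSolutionOn [NeZero N] (hη : 0 < W.η) (hα : 0 < W.α) (hv : ∀ k, 0 < W.vref k)
    {c κ₀ : ℝ} (hc : 0 < c) (hκ₀ : 0 < κ₀) (h23 : W.DecreaseOnS c) (hK : W.PhaseErrorBound κ₀)
    (x₀ : DvocState N) :
    ∃ γ : ℝ → DvocState N, (γ 0 = x₀ ∧ W.IsSolutionOn γ (Ici 0)) ∧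
      ∀ γ' : ℝ → DvocState N, γ' 0 = x₀ → W.IsSolutionOn γ' (Ici 0) → ∀ t, 0 ≤ t → γ' t = γ t := by
  obtain ⟨γ, hγ0, hγ⟩ := W.exists_isSolutionOn hη hα hv hc hκ₀ h23 hK x₀
  refine ⟨γ, ⟨hγ0, hγ⟩, fun γ' hγ'0 hγ' t ht => ?_⟩
  exact W.isSolutionOn_unique hη hα hv hc hκ₀ h23 hK hγ' hγ (by rw [hγ'0, hγ0]) ht

/-! ## §7 On `𝒮 ∖ {0}` every solution IS a logistic ray and synchronises (append 2026-08-27, same sources)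

[ColombinoEtAl2019, proof of Prop. 10] «𝒮 ∖ {0} is invariant under the dynamics»: with uniqueness (§6)
the solution of (17) issued from `S(a,b) ≠ 0` is the explicit ray of §5, so it converges to the nominal
synchronous state `r⁻¹S(a,b) ∈ 𝒮 ∩ 𝒜` (`r² = a² + b²`) — among the solutions starting on `𝒮`, only the
rest solution realises the alternative «v(t) → 0» of the dichotomy. -/

/-- Scaling the `S`-embedding: `ρ · S(a,b) = S(ρa, ρb)` (the tree's `DVOCStabilityCondition` has the
same identity privately). [folklore] -/
private theorem smul_embS' (ρ a b : ℝ) : ρ • W.embS a b = W.embS (ρ * a) (ρ * b) := by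
  refine Prod.ext (funext fun k => ?_) (funext fun k => ?_)
  · simp only [embS, Prod.smul_fst, Pi.smul_apply, smul_eq_mul]; ring
  · simp only [embS, Prod.smul_snd, Pi.smul_apply, smul_eq_mul]; ring

/-- The nominal synchronous state on the ray through `S(a,b) ≠ 0` lies in `𝒮 ∩ 𝒜`:
`r⁻¹S(a,b) ∈ 𝒯`, `r = √(a² + b²)`. [cite: ColombinoEtAl2019, §2.1 (𝒮, 𝒜, 𝒯 = 𝒮 ∩ 𝒜)] -/
theorem inv_sqrt_smul_embS_mem_target {a b : ℝ} (hab : 0 < a ^ 2 + b ^ 2) :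
    (Real.sqrt (a ^ 2 + b ^ 2))⁻¹ • W.embS a b ∈ W.target := by
  set r := Real.sqrt (a ^ 2 + b ^ 2) with hr
  have hr0 : 0 < r := Real.sqrt_pos.2 hab
  have hrr : r ^ 2 = a ^ 2 + b ^ 2 := Real.sq_sqrt hab.le
  refine ⟨⟨r⁻¹ * a, r⁻¹ * b, W.smul_embS' _ _ _⟩, fun k => ?_⟩
  rw [W.smul_embS', W.nsq_embS]
  have : (r⁻¹ * a) ^ 2 + (r⁻¹ * b) ^ 2 = 1 := by
    field_simp
    linarith [hrr]
  rw [this, mul_one]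

/-- **Every solution of (17) issued from a nonzero synchronous state is the logistic ray** (§5) —
uniqueness (§6) + `isSolutionOn_logisticRay`: for `t ≥ 0`, `v(t) = ρ(t) S(a,b)` with `ρ₀ = 1`,
`r² = a² + b² > 0` (hypotheses of the tree's Prop. 3 with `α > 0`, for the uniqueness).
[cite: ColombinoEtAl2019, proof of Prop. 10 («𝒮 ∖ {0} is invariant under the dynamics»)] -/
theorem eq_logisticRay_of_embS [NeZero N] (hη : 0 < W.η) (hα : 0 < W.α) (hv : ∀ k, 0 < W.vref k)
    {c κ₀ : ℝ} (hc : 0 < c) (hκ₀ : 0 < κ₀) (h23 : W.DecreaseOnS c) (hK : W.PhaseErrorBound κ₀)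
    {a b : ℝ} {γ : ℝ → DvocState N} (hsol : W.IsSolutionOn γ (Ici 0)) (h0 : γ 0 = W.embS a b)
    {t : ℝ} (ht : 0 ≤ t) : γ t = W.logisticAmp (a ^ 2 + b ^ 2) 1 t • W.embS a b := by
  have hv' : ∀ k, W.vref k ≠ 0 := fun k => (hv k).ne'
  have hray := W.isSolutionOn_logisticRay hv' hη.le hα.le a b one_pos
  refine W.isSolutionOn_unique hη hα hv hc hκ₀ h23 hK hsol hray ?_ ht
  rw [h0, W.logisticAmp_zero _ one_pos, one_smul]

/-- **… and converges to the nominal synchronous state `r⁻¹S(a,b) ∈ 𝒮 ∩ 𝒜`** (`S(a,b) ≠ 0`, i.e.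
`a² + b² > 0`): among the solutions of (17) starting on `𝒮`, only the rest solution realises the
alternative «v(t) → 0». MODELLED: reduced model (17). [cite: ColombinoEtAl2019, Prop. 10 / Thm. 1
(phase and magnitude synchronisation on 𝒮)] -/
theorem tendsto_of_embS [NeZero N] (hη : 0 < W.η) (hα : 0 < W.α) (hv : ∀ k, 0 < W.vref k)
    {c κ₀ : ℝ} (hc : 0 < c) (hκ₀ : 0 < κ₀) (h23 : W.DecreaseOnS c) (hK : W.PhaseErrorBound κ₀)
    {a b : ℝ} (hab : 0 < a ^ 2 + b ^ 2) {γ : ℝ → DvocState N} (hsol : W.IsSolutionOn γ (Ici 0))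
    (h0 : γ 0 = W.embS a b) :
    Tendsto γ atTop (𝓝 ((Real.sqrt (a ^ 2 + b ^ 2))⁻¹ • W.embS a b)) ∧
      (Real.sqrt (a ^ 2 + b ^ 2))⁻¹ • W.embS a b ∈ W.target := by
  refine ⟨?_, W.inv_sqrt_smul_embS_mem_target hab⟩
  have hlim : Tendsto (fun t => W.logisticAmp (a ^ 2 + b ^ 2) 1 t • W.embS a b) atTop
      (𝓝 ((Real.sqrt (a ^ 2 + b ^ 2))⁻¹ • W.embS a b)) :=
    (W.tendsto_logisticAmp hη hα hab 1).smul_const (W.embS a b)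
  refine hlim.congr' ?_
  filter_upwards [eventually_ge_atTop (0 : ℝ)] with t ht
  exact (W.eq_logisticRay_of_embS hη hα hv hc hκ₀ h23 hK hsol h0 ht).symm

/-! ## §8 The reduced model under Proposition 2's PRINTED power-flow hypotheses — every `N ≥ 1`, no
operator norm (append 2026-08-27, same sources)

[GrossEtAl2019, Prop. 2, p0005 L99–L120]: «Condition 2 is satisfied if the steady-state angles θ_jk*,
the set-points p_k*, q_k*, v_k*, and the steady-state branch powers p_jk*, q_jk* satisfy Condition 1,
|θ_jk*| ≤ π/2 …, and for all k: Σ_j (cos κ/v_k*²)|p_jk*| + (sin κ/v_k*²)|q_jk*| + α ≤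
(v*_min²/(2v*_max²)) λ₂(L) − c» (the `η`-inequality concerns the line dynamics only and is not needed
for (17)). With the tree's `decreaseOnS_of_proposition2` and `phaseErrorBound_of_bounds`
(`κ₀ = κ_K + 2d`) the conclusions of §§3–6 follow from finitely many inequalities on the instance data
plus one variational `λ ≤ λ₂(L)` certificate — for a COMPLETE converter graph with weights `≥ w_min`
that certificate is `DvocReduced.lam_of_complete` (`λ = N·w_min`, DVOCLineConvergence §14). The
sublevel region of attraction stays explicit: `V` with `α₁ = c/(5η(κ_K + 2d)²)`. -/

/-- Proposition 2's printed hypotheses (branch-power form with rotation angle `κ ∈ [0, π/2]`) deliver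
the hypothesis core of §§2–6 with `κ₀ = κ_K + 2d`: (23) and the phase-error bound.
[cite: GrossEtAl2019, Prop. 2 with Lemma 2 and Prop. 3] -/
theorem core_of_proposition2 [NeZero N] (hsym : ∀ k j, W.w k j = W.w j k) (hw : ∀ k j, 0 ≤ W.w k j)
    (hα : 0 < W.α) (hv : ∀ k, 0 < W.vref k) {κ lam c vmin vmax κK d : ℝ}
    (hκ0 : 0 ≤ κ) (hκ1 : κ ≤ π / 2) (hc : 0 < c)
    (hlam : ∀ z : Fin N → ℝ,
      lam * pairNormSq z ≤ N * (1 / 2 * ∑ i, ∑ j, W.w i j * (z i - z j) ^ 2))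
    (hang : ∀ j k, |W.θ j - W.θ k| ≤ π / 2)
    (hvmin : 0 < vmin) (hmin : ∀ k, vmin ≤ W.vref k) (hmax : ∀ k, W.vref k ≤ vmax)
    (hprop2 : ∀ k, ∑ j, (cos κ / W.vref k ^ 2 * |W.pBranch κ k j|
        + sin κ / W.vref k ^ 2 * |W.qBranch κ k j|) + W.α ≤ vmin ^ 2 / (2 * vmax ^ 2) * lam - c)
    (hκK : 0 < κK) (hKk : ∀ k, W.nodeGain k ^ 2 + W.nodeRot k ^ 2 ≤ κK ^ 2)
    (hd : ∀ k, ∑ j, W.w k j ≤ d) :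
    0 < κK + 2 * d ∧ W.DecreaseOnS c ∧ W.PhaseErrorBound (κK + 2 * d) := by
  have k0 : Fin N := ⟨0, Nat.pos_of_ne_zero (NeZero.ne N)⟩
  have hd0 : 0 ≤ d := (Finset.sum_nonneg fun j _ => hw k0 j).trans (hd k0)
  exact ⟨by positivity,
    W.decreaseOnS_of_proposition2 hsym hw hv hα.le hκ0 hκ1 hc hlam hang hvmin hmin hmax hprop2,
    W.phaseErrorBound_of_bounds hsym hw hv hκK.le hKk hd⟩

/-- **THE DICHOTOMY for (17) under Proposition 2 as printed** [cite: GrossEtAl2019, Prop. 2, Prop. 3,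
Thm. 1]: for `N ≥ 1` converters with symmetric nonnegative weights, gains `η, α > 0`, set-points
`0 < v_min ≤ v_k* ≤ v_max`, steady-state angles `|θ_j − θ_k| ≤ π/2`, a margin `c > 0`, a certified
`λ ≤ λ₂(L)` (variational form), per-node data bounds `‖K_k‖ ≤ κ_K`, `Σ_j‖Y_jk‖ ≤ d`, and Prop. 2's
PRINTED branch-power inequality (rotation angle `κ ∈ [0, π/2]`): EVERY solution of the reduced model
(17) on `[0, ∞)` satisfies `dist(v(t), 𝒮 ∩ 𝒜) → 0` OR `v(t) → 0`. MODELLED: reduced model (17). -/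
theorem prop2_dichotomy [NeZero N] (hsym : ∀ k j, W.w k j = W.w j k) (hw : ∀ k j, 0 ≤ W.w k j)
    (hη : 0 < W.η) (hα : 0 < W.α) (hv : ∀ k, 0 < W.vref k) {κ lam c vmin vmax κK d : ℝ}
    (hκ0 : 0 ≤ κ) (hκ1 : κ ≤ π / 2) (hc : 0 < c)
    (hlam : ∀ z : Fin N → ℝ,
      lam * pairNormSq z ≤ N * (1 / 2 * ∑ i, ∑ j, W.w i j * (z i - z j) ^ 2))
    (hang : ∀ j k, |W.θ j - W.θ k| ≤ π / 2)
    (hvmin : 0 < vmin) (hmin : ∀ k, vmin ≤ W.vref k) (hmax : ∀ k, W.vref k ≤ vmax)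
    (hprop2 : ∀ k, ∑ j, (cos κ / W.vref k ^ 2 * |W.pBranch κ k j|
        + sin κ / W.vref k ^ 2 * |W.qBranch κ k j|) + W.α ≤ vmin ^ 2 / (2 * vmax ^ 2) * lam - c)
    (hκK : 0 < κK) (hKk : ∀ k, W.nodeGain k ^ 2 + W.nodeRot k ^ 2 ≤ κK ^ 2)
    (hd : ∀ k, ∑ j, W.w k j ≤ d)
    {γ : ℝ → DvocState N} (hsol : W.IsSolutionOn γ (Ici 0)) :
    Tendsto (fun t => infDist (γ t) W.target) atTop (𝓝 0) ∨ Tendsto γ atTop (𝓝 0) := by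
  obtain ⟨hκ₀, h23, hK⟩ := W.core_of_proposition2 hsym hw hα hv hκ0 hκ1 hc hlam hang hvmin hmin hmax hprop2 hκK hKk hd
  exact W.tendsto_infDist_target_or_tendsto_zero hη hα hv hc hκ₀ h23 hK hsol

/-- **The explicit region of attraction of `𝒮 ∩ 𝒜` under Proposition 2 as printed**: with
`α₁ = c/(5η(κ_K + 2d)²)`, every solution of (17) on `[0, ∞)` with `V(v(0)) < V(0) = ½ηαα₁Σ_k v_k*²`
has `dist(v(t), 𝒮 ∩ 𝒜) → 0`. [cite: GrossEtAl2019, Prop. 2, Prop. 3 with Thm. 1]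
MODELLED: reduced model (17). -/
theorem prop2_tendsto_infDist_target_of_V_lt [NeZero N] (hsym : ∀ k j, W.w k j = W.w j k) (hw : ∀ k j, 0 ≤ W.w k j)
    (hη : 0 < W.η) (hα : 0 < W.α) (hv : ∀ k, 0 < W.vref k) {κ lam c vmin vmax κK d : ℝ}
    (hκ0 : 0 ≤ κ) (hκ1 : κ ≤ π / 2) (hc : 0 < c)
    (hlam : ∀ z : Fin N → ℝ,
      lam * pairNormSq z ≤ N * (1 / 2 * ∑ i, ∑ j, W.w i j * (z i - z j) ^ 2))
    (hang : ∀ j k, |W.θ j - W.θ k| ≤ π / 2)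
    (hvmin : 0 < vmin) (hmin : ∀ k, vmin ≤ W.vref k) (hmax : ∀ k, W.vref k ≤ vmax)
    (hprop2 : ∀ k, ∑ j, (cos κ / W.vref k ^ 2 * |W.pBranch κ k j|
        + sin κ / W.vref k ^ 2 * |W.qBranch κ k j|) + W.α ≤ vmin ^ 2 / (2 * vmax ^ 2) * lam - c)
    (hκK : 0 < κK) (hKk : ∀ k, W.nodeGain k ^ 2 + W.nodeRot k ^ 2 ≤ κK ^ 2)
    (hd : ∀ k, ∑ j, W.w k j ≤ d)
    {γ : ℝ → DvocState N} (hsol : W.IsSolutionOn γ (Ici 0))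
    (hlt : W.V (W.alpha1 c (κK + 2 * d)) (γ 0) < W.V (W.alpha1 c (κK + 2 * d)) 0) :
    Tendsto (fun t => infDist (γ t) W.target) atTop (𝓝 0) := by
  obtain ⟨hκ₀, h23, hK⟩ := W.core_of_proposition2 hsym hw hα hv hκ0 hκ1 hc hlam hang hvmin hmin hmax hprop2 hκK hKk hd
  exact W.tendsto_infDist_target_of_V_lt hη hα hv hc hκ₀ h23 hK hsol hlt

/-- **`𝒮 ∩ 𝒜` is Lyapunov stable for (17) under Proposition 2 as printed** (uniformly over solutions).
[cite: GrossEtAl2019, Prop. 2, Prop. 3 (24) with Thm. 1] MODELLED: reduced model (17). -/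
theorem prop2_target_stable [NeZero N] (hsym : ∀ k j, W.w k j = W.w j k) (hw : ∀ k j, 0 ≤ W.w k j)
    (hη : 0 < W.η) (hα : 0 < W.α) (hv : ∀ k, 0 < W.vref k) {κ lam c vmin vmax κK d : ℝ}
    (hκ0 : 0 ≤ κ) (hκ1 : κ ≤ π / 2) (hc : 0 < c)
    (hlam : ∀ z : Fin N → ℝ,
      lam * pairNormSq z ≤ N * (1 / 2 * ∑ i, ∑ j, W.w i j * (z i - z j) ^ 2))
    (hang : ∀ j k, |W.θ j - W.θ k| ≤ π / 2)
    (hvmin : 0 < vmin) (hmin : ∀ k, vmin ≤ W.vref k) (hmax : ∀ k, W.vref k ≤ vmax)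
    (hprop2 : ∀ k, ∑ j, (cos κ / W.vref k ^ 2 * |W.pBranch κ k j|
        + sin κ / W.vref k ^ 2 * |W.qBranch κ k j|) + W.α ≤ vmin ^ 2 / (2 * vmax ^ 2) * lam - c)
    (hκK : 0 < κK) (hKk : ∀ k, W.nodeGain k ^ 2 + W.nodeRot k ^ 2 ≤ κK ^ 2)
    (hd : ∀ k, ∑ j, W.w k j ≤ d) {ε : ℝ} (hε : 0 < ε) :
    ∃ δ > 0, ∀ γ : ℝ → DvocState N, W.IsSolutionOn γ (Ici 0) →
      infDist (γ 0) W.target < δ → ∀ t, 0 ≤ t → infDist (γ t) W.target < ε := by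
  obtain ⟨hκ₀, h23, hK⟩ := W.core_of_proposition2 hsym hw hα hv hκ0 hκ1 hc hlam hang hvmin hmin hmax hprop2 hκK hKk hd
  exact W.target_stable hη hα hv hc hκ₀ h23 hK hε

/-- **Well-posedness of (17) on `[0, ∞)` under Proposition 2 as printed**: from every initial state
EXACTLY ONE solution. [cite: GrossEtAl2019, Prop. 2, Prop. 3 / Thm. 1 (the flow φ_f(t, x₀))]
MODELLED: reduced model (17). -/
theorem prop2_existsUnique_isSolutionOn [NeZero N] (hsym : ∀ k j, W.w k j = W.w j k) (hw : ∀ k j, 0 ≤ W.w k j)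
    (hη : 0 < W.η) (hα : 0 < W.α) (hv : ∀ k, 0 < W.vref k) {κ lam c vmin vmax κK d : ℝ}
    (hκ0 : 0 ≤ κ) (hκ1 : κ ≤ π / 2) (hc : 0 < c)
    (hlam : ∀ z : Fin N → ℝ,
      lam * pairNormSq z ≤ N * (1 / 2 * ∑ i, ∑ j, W.w i j * (z i - z j) ^ 2))
    (hang : ∀ j k, |W.θ j - W.θ k| ≤ π / 2)
    (hvmin : 0 < vmin) (hmin : ∀ k, vmin ≤ W.vref k) (hmax : ∀ k, W.vref k ≤ vmax)
    (hprop2 : ∀ k, ∑ j, (cos κ / W.vref k ^ 2 * |W.pBranch κ k j|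
        + sin κ / W.vref k ^ 2 * |W.qBranch κ k j|) + W.α ≤ vmin ^ 2 / (2 * vmax ^ 2) * lam - c)
    (hκK : 0 < κK) (hKk : ∀ k, W.nodeGain k ^ 2 + W.nodeRot k ^ 2 ≤ κK ^ 2)
    (hd : ∀ k, ∑ j, W.w k j ≤ d) (x₀ : DvocState N) :
    ∃ γ : ℝ → DvocState N, (γ 0 = x₀ ∧ W.IsSolutionOn γ (Ici 0)) ∧
      ∀ γ' : ℝ → DvocState N, γ' 0 = x₀ → W.IsSolutionOn γ' (Ici 0) → ∀ t, 0 ≤ t → γ' t = γ t := by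
  obtain ⟨hκ₀, h23, hK⟩ := W.core_of_proposition2 hsym hw hα hv hκ0 hκ1 hc hlam hang hvmin hmin hmax hprop2 hκK hKk hd
  exact W.existsUnique_isSolutionOn hη hα hv hc hκ₀ h23 hK x₀

/-! ## §9 The equilibria of (17) are EXACTLY `(𝒮 ∩ 𝒜) ∪ {0}` (append 2026-08-27, same sources)

[GrossEtAl2019, §IV-A p0005 L10–L16] («all elements of 𝒯 are equilibria … 𝒯₀ := 𝒯 ∪ {0ₙ}») read for
the reduced model: every point of `𝒮 ∩ 𝒜` and the origin are rest points of (17) (tree `field_embS`);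
the converse is a corollary of the typed dichotomy (§3): a rest point is a constant solution, which
approaches `𝒮 ∩ 𝒜` or `0` only by lying in the closed set `𝒮 ∩ 𝒜` or being `0`. -/

/-- Every point of `𝒮 ∩ 𝒜` is a rest point of (17): `f(S(a,b)) = ηα(1 − (a² + b²))S(a,b) = 0` for
`a² + b² = 1`. [cite: GrossEtAl2019, §IV-A (16) («all elements of 𝒯 are equilibria»)] -/
theorem field_eq_zero_of_mem_target [NeZero N] (hv : ∀ k, W.vref k ≠ 0) {v : DvocState N}
    (hT : v ∈ W.target) : W.field v = 0 := by
  rw [W.target_eq_image hv] at hT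
  obtain ⟨p, hp, rfl⟩ := hT
  have hp' : p.1 ^ 2 + p.2 ^ 2 = 1 := hp
  rw [W.field_embS hv, hp', sub_self, mul_zero, zero_smul]

/-- The origin is a rest point of (17): `f(0) = 0`. [cite: ColombinoEtAl2019, Prop. 8 («the
equilibrium v̄ = 0»)] -/
theorem field_zero (hv : ∀ k, W.vref k ≠ 0) : W.field (0 : DvocState N) = 0 := by
  have h := W.field_embS hv 0 0
  rw [W.embS_zero_zero] at h
  rw [h, smul_zero]

/-- **The equilibria of the reduced model (17) are exactly `(𝒮 ∩ 𝒜) ∪ {0}`** (hypotheses of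
`tendsto_infDist_target_or_tendsto_zero`): `f(v) = 0 ↔ v ∈ 𝒮 ∩ 𝒜 ∨ v = 0`.
[cite: GrossEtAl2019, §IV-A (16), Prop. 3 with Thm. 1 (corollary: no other equilibria);
ColombinoEtAl2019, Prop. 8] MODELLED: reduced model (17). -/
theorem field_eq_zero_iff [NeZero N] (hη : 0 < W.η) (hα : 0 < W.α) (hv : ∀ k, 0 < W.vref k)
    {c κ₀ : ℝ} (hc : 0 < c) (hκ₀ : 0 < κ₀) (h23 : W.DecreaseOnS c) (hK : W.PhaseErrorBound κ₀)
    (v : DvocState N) : W.field v = 0 ↔ v ∈ W.target ∨ v = 0 := by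
  have hv' : ∀ k, W.vref k ≠ 0 := fun k => (hv k).ne'
  constructor
  · intro hx
    have hsol : W.IsSolutionOn (fun _ : ℝ => v) (Ici 0) := fun t _ => by
      rw [hx]; exact hasDerivWithinAt_const t (Ici 0) v
    rcases W.tendsto_infDist_target_or_tendsto_zero hη hα hv hc hκ₀ h23 hK hsol with hT | h0
    · left
      have hd : infDist v W.target = 0 := tendsto_const_nhds_iff.1 hT
      have hne : W.target.Nonempty := by
        rw [W.target_eq_image hv']
        exact ⟨_, ⟨(1, 0), by norm_num, rfl⟩⟩
      exact ((W.isCompact_target hv').isClosed.mem_iff_infDist_zero hne).2 hd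
    · exact Or.inr (tendsto_const_nhds_iff.1 h0)
  · rintro (hT | h0)
    · exact W.field_eq_zero_of_mem_target hv' hT
    · rw [h0]; exact W.field_zero hv'

/-! ## §10 The control objective «voltage magnitude» along solutions approaching `𝒮 ∩ 𝒜`
(append 2026-08-27, same sources)

[GrossEtAl2019, §II-C (7) p0003 L117–L121; §IV-A p0005 L14–L15 («they also satisfy all control
objectives»)]: along a solution of (17) with `dist(v(t), 𝒮 ∩ 𝒜) → 0` the squared amplitudes converge
to the set-points, `‖v_k(t)‖² → v_k*²` (tree `Literature.Analysis.ODE.tendsto_comp_of_tendsto_infDist`);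
with the dichotomy (§3) and `normS2 → 0` this is the reduced model's version of the objectives. -/

/-- **Voltage regulation along solutions approaching `𝒮 ∩ 𝒜`**: `dist(v(t), 𝒮 ∩ 𝒜) → 0` implies
`‖v_k(t)‖² → v_k*²` for every `k` (`N ≥ 1`, `v_k* ≠ 0`). [cite: GrossEtAl2019, §II-C (7) with §IV-A
(16)] MODELLED: reduced model (17). -/
theorem tendsto_nsq_of_tendsto_infDist_target [NeZero N] (hv : ∀ k, W.vref k ≠ 0)
    {γ : ℝ → DvocState N} (hT : Tendsto (fun t => infDist (γ t) W.target) atTop (𝓝 0)) (k : Fin N) :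
    Tendsto (fun t => dvocNsq (γ t) k) atTop (𝓝 (W.vref k ^ 2)) := by
  have hne : W.target.Nonempty := by
    rw [W.target_eq_image hv]
    exact ⟨_, ⟨(1, 0), by norm_num, rfl⟩⟩
  have hcont : Continuous fun v : DvocState N => dvocNsq v k := by unfold dvocNsq; fun_prop
  exact tendsto_comp_of_tendsto_infDist (W.isCompact_target hv) hne hcont (fun y hy => hy.2 k) hT

/-- **The reduced-model dichotomy in the words of the control objectives**: under the hypotheses of
`tendsto_infDist_target_or_tendsto_zero`, EVERY solution of (17) on `[0, ∞)` either tends to `0` or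
achieves voltage regulation `‖v_k(t)‖² → v_k*²` at every converter together with phase
synchronisation `‖v(t)‖²_S → 0`. [cite: GrossEtAl2019, Prop. 3 / Thm. 1 with §II-C (7)]
MODELLED: reduced model (17). -/
theorem objectives_or_tendsto_zero [NeZero N] (hη : 0 < W.η) (hα : 0 < W.α) (hv : ∀ k, 0 < W.vref k)
    {c κ₀ : ℝ} (hc : 0 < c) (hκ₀ : 0 < κ₀) (h23 : W.DecreaseOnS c) (hK : W.PhaseErrorBound κ₀)
    {γ : ℝ → DvocState N} (hsol : W.IsSolutionOn γ (Ici 0)) :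
    Tendsto γ atTop (𝓝 0) ∨
      ((∀ k, Tendsto (fun t => dvocNsq (γ t) k) atTop (𝓝 (W.vref k ^ 2))) ∧
        Tendsto (fun t => W.normS2 (γ t)) atTop (𝓝 0)) := by
  have hv' : ∀ k, W.vref k ≠ 0 := fun k => (hv k).ne'
  rcases W.tendsto_infDist_target_or_tendsto_zero hη hα hv hc hκ₀ h23 hK hsol with hT | h0
  · right
    refine ⟨fun k => W.tendsto_nsq_of_tendsto_infDist_target hv' hT k, ?_⟩
    -- `‖·‖²_S` is continuous and vanishes on `𝒮 ∩ 𝒜 ⊆ 𝒮`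
    have hΛ : W.Lam ≠ 0 := (W.Lam_pos hv).ne'
    have hne : W.target.Nonempty := by
      rw [W.target_eq_image hv']
      exact ⟨_, ⟨(1, 0), by norm_num, rfl⟩⟩
    exact tendsto_comp_of_tendsto_infDist (W.isCompact_target hv') hne W.continuous_normS2
      (fun y hy => (W.normS2_eq_zero_iff hΛ y).2 hy.1) hT
  · exact Or.inl h0

/-! ## §11 The control objectives «power injection» (8) and «synchronous frequency» (6) for the reduced
model (17) (append 2026-08-27, same sources)

[GrossEtAl2019, Definition 2 and §II-C (6), (8) p0003 L97–L133; §II-B Definition 1 («i^s_o(v) := 𝒴v»,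
«R(κ)i^s_o(v) = R(κ)𝒴v = 𝓛v») p0003 L1–L31; Prop. 1 p0004 L60–L69; §IV-A p0005 L14–L15 («they also
satisfy all control objectives»)]. Under the quasi-steady-state network model of (17) the output current
of converter `k` is `i_{o,k} = i^s_{o,k}(v) = R(κ)ᵀ(𝓛v)_k`, so the instantaneous powers of Definition 2
are the readouts `p_k(v) = v_kᵀR(κ)ᵀ(𝓛v)_k`, `q_k(v) = v_kᵀJR(κ)ᵀ(𝓛v)_k` (`instPqs`, `instQqs`; the
parameter record carries no line angle, so `κ` is an argument — the physical readout is the one at the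
network's `κ = tan⁻¹(ρω₀)`, cf. `DvocLines.instP_iss_of_InS`, and every identity below holds for each
`κ` with the consistent set-points `p_k* = Σ_j p_jk*(κ)`, `q_k* = Σ_j q_jk*(κ)` of (36) at that `κ`).
PROVED: on `𝒮`, `p_k = p_k*‖v_k‖²/v_k*²`, `q_k = q_k*‖v_k‖²/v_k*²` (Prop. 1: `K_k v_k = (𝓛v)_k` on `𝒮`,
tree `Kang_eq_lap_of_InS`, and the algebra `Kpq_readout`); on `𝒮 ∩ 𝒜`, `p_k = p_k*`, `q_k = q_k*`;
along every curve with `dist(v(t), 𝒮 ∩ 𝒜) → 0`: `p_k → p_k*`, `q_k → q_k*`, `f(v(t)) → 0` (objective (6)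
in the rotating frame: the right-hand side of (17) dies out; tree `field_eq_zero_of_mem_target`);
packaged with the dichotomy of §3 in `objectives_or_tendsto_zero'`. MODELLED: reduced model (17). -/

/-- Instantaneous ACTIVE power of converter `k` in the reduced model: `p_k(v) := v_kᵀ i^s_{o,k}(v)` with
the quasi-steady-state output current `i^s_{o,k}(v) = R(κ)ᵀ(𝓛v)_k` (Definition 2 with Definition 1 and
`R(κ)𝒴 = 𝓛`). [cite: GrossEtAl2019, Definition 2 with Definition 1] MODELLED: reduced model (17). -/
def instPqs (κ : ℝ) (v : DvocState N) (k : Fin N) : ℝ :=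
  v.1 k * (cos κ * W.lap₁ v k + sin κ * W.lap₂ v k)
    + v.2 k * (-sin κ * W.lap₁ v k + cos κ * W.lap₂ v k)

/-- Instantaneous REACTIVE power `q_k(v) := v_kᵀ J i^s_{o,k}(v)`, `J = R(π/2)`, in the reduced model.
[cite: GrossEtAl2019, Definition 2 with Definition 1] MODELLED: reduced model (17). -/
def instQqs (κ : ℝ) (v : DvocState N) (k : Fin N) : ℝ :=
  v.2 k * (cos κ * W.lap₁ v k + sin κ * W.lap₂ v k)
    - v.1 k * (-sin κ * W.lap₁ v k + cos κ * W.lap₂ v k)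

/-- `p_k(v)` is continuous (polynomial). [cite: GrossEtAl2019, Definition 2] -/
theorem continuous_instPqs (κ : ℝ) (k : Fin N) : Continuous fun v : DvocState N => W.instPqs κ v k := by
  unfold instPqs lap₁ lap₂; fun_prop

/-- `q_k(v)` is continuous. [cite: GrossEtAl2019, Definition 2] -/
theorem continuous_instQqs (κ : ℝ) (k : Fin N) : Continuous fun v : DvocState N => W.instQqs κ v k := by
  unfold instQqs lap₁ lap₂; fun_prop

/-- **Powers on the synchronous set**: for `v ∈ 𝒮`, `p_k(v) = p_k*‖v_k‖²/v_k*²` and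
`q_k(v) = q_k*‖v_k‖²/v_k*²` (all `v_k* ≠ 0`; Prop. 1 on `𝒮` and `R(κ)ᵀR(κ) = I₂`).
[cite: GrossEtAl2019, Prop. 1 with §IV-C («(𝒦 − 𝓛)v = 0 for v ∈ 𝒮»)] MODELLED: reduced model (17). -/
theorem instPqs_of_InS {v : DvocState N} (hv : W.InS v) (hne : ∀ k, W.vref k ≠ 0) (κ : ℝ)
    (k : Fin N) :
    W.instPqs κ v k = W.pSet κ k * dvocNsq v k / W.vref k ^ 2 ∧
      W.instQqs κ v k = W.qSet κ k * dvocNsq v k / W.vref k ^ 2 := by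
  obtain ⟨hK1, hK2⟩ := W.Kpq_apply_eq_Kang_apply κ v (hne k)
  obtain ⟨hL1, hL2⟩ := W.Kang_eq_lap_of_InS hv hne k
  obtain ⟨r1, r2⟩ := Kpq_readout κ (W.pSet κ k) (W.qSet κ k) (W.vref k) (v.1 k) (v.2 k)
  rw [hK1, hL1] at r1 r2
  rw [hK2, hL2] at r1 r2
  constructor
  · simp only [instPqs, dvocNsq]
    linear_combination r1
  · simp only [instQqs, dvocNsq]
    linear_combination r2

/-- **Objective (8) ON `𝒮 ∩ 𝒜`**: `p_k(v) = p_k*`, `q_k(v) = q_k*` at every point of the target set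
(all `v_k* ≠ 0`). [cite: GrossEtAl2019, §II-C (8) with §IV-A (16)] MODELLED: reduced model (17). -/
theorem instPqs_of_mem_target {v : DvocState N} (hT : v ∈ W.target) (hne : ∀ k, W.vref k ≠ 0)
    (κ : ℝ) (k : Fin N) : W.instPqs κ v k = W.pSet κ k ∧ W.instQqs κ v k = W.qSet κ k := by
  obtain ⟨h1, h2⟩ := W.instPqs_of_InS hT.1 hne κ k
  rw [hT.2 k, mul_div_assoc, div_self (pow_ne_zero 2 (hne k)), mul_one] at h1 h2
  exact ⟨h1, h2⟩

/-- **Objective (8) along curves approaching `𝒮 ∩ 𝒜`**: `dist(v(t), 𝒮 ∩ 𝒜) → 0` implies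
`p_k(v(t)) → p_k*` and `q_k(v(t)) → q_k*` (`N ≥ 1`, all `v_k* ≠ 0`). [cite: GrossEtAl2019, §II-C (8)
with §IV-A (16)] MODELLED: reduced model (17). -/
theorem tendsto_instPqs_of_tendsto_infDist_target [NeZero N] (hv : ∀ k, W.vref k ≠ 0) (κ : ℝ)
    {γ : ℝ → DvocState N} (hT : Tendsto (fun t => infDist (γ t) W.target) atTop (𝓝 0)) (k : Fin N) :
    Tendsto (fun t => W.instPqs κ (γ t) k) atTop (𝓝 (W.pSet κ k)) ∧
      Tendsto (fun t => W.instQqs κ (γ t) k) atTop (𝓝 (W.qSet κ k)) := by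
  have hne : W.target.Nonempty := by
    rw [W.target_eq_image hv]
    exact ⟨_, ⟨(1, 0), by norm_num, rfl⟩⟩
  exact ⟨tendsto_comp_of_tendsto_infDist (W.isCompact_target hv) hne (W.continuous_instPqs κ k)
      (fun y hy => (W.instPqs_of_mem_target hy hv κ k).1) hT,
    tendsto_comp_of_tendsto_infDist (W.isCompact_target hv) hne (W.continuous_instQqs κ k)
      (fun y hy => (W.instPqs_of_mem_target hy hv κ k).2) hT⟩

/-- **Objective (6), rotating frame, along curves approaching `𝒮 ∩ 𝒜`**: `dist(v(t), 𝒮 ∩ 𝒜) → 0`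
implies `f(v(t)) → 0` — the right-hand side of (17) dies out, i.e. in the static frame
`(d/dt)v_k − ω₀Jv_k → 0` (`N ≥ 1`, all `v_k* ≠ 0`; `f = 0` on `𝒮 ∩ 𝒜`). [cite: GrossEtAl2019, §II-C (6)
with §IV-A (16)] MODELLED: reduced model (17). -/
theorem tendsto_field_of_tendsto_infDist_target [NeZero N] (hv : ∀ k, W.vref k ≠ 0)
    {γ : ℝ → DvocState N} (hT : Tendsto (fun t => infDist (γ t) W.target) atTop (𝓝 0)) :
    Tendsto (fun t => W.field (γ t)) atTop (𝓝 0) := by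
  have hne : W.target.Nonempty := by
    rw [W.target_eq_image hv]
    exact ⟨_, ⟨(1, 0), by norm_num, rfl⟩⟩
  exact tendsto_comp_of_tendsto_infDist (W.isCompact_target hv) hne W.continuous_field
    (fun y hy => W.field_eq_zero_of_mem_target hv hy) hT

/-- **The reduced-model dichotomy in the words of ALL the control objectives of §II-C**: under the
hypotheses of `tendsto_infDist_target_or_tendsto_zero`, EVERY solution of (17) on `[0, ∞)` either tends
to `0` or, asymptotically, has vanishing rotating-frame velocity `f(v(t)) → 0` ((6): every terminal
voltage rotates at `ω₀`), regulates every amplitude `‖v_k(t)‖² → v_k*²` (7), injects the prescribed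
powers `p_k(v(t)) → p_k*`, `q_k(v(t)) → q_k*` (8) (readouts at any angle `κ` with the consistent
set-points at that `κ`), and synchronises in phase `‖v(t)‖²_S → 0`. [cite: GrossEtAl2019, Prop. 3 /
Thm. 1 with §II-C (6)–(8) and §IV-A (16)] MODELLED: reduced model (17); nothing here is a grid. -/
theorem objectives_or_tendsto_zero' [NeZero N] (hη : 0 < W.η) (hα : 0 < W.α) (hv : ∀ k, 0 < W.vref k)
    {c κ₀ : ℝ} (hc : 0 < c) (hκ₀ : 0 < κ₀) (h23 : W.DecreaseOnS c) (hK : W.PhaseErrorBound κ₀)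
    (κ : ℝ) {γ : ℝ → DvocState N} (hsol : W.IsSolutionOn γ (Ici 0)) :
    Tendsto γ atTop (𝓝 0) ∨
      (Tendsto (fun t => W.field (γ t)) atTop (𝓝 0) ∧
        (∀ k, Tendsto (fun t => dvocNsq (γ t) k) atTop (𝓝 (W.vref k ^ 2))) ∧
        (∀ k, Tendsto (fun t => W.instPqs κ (γ t) k) atTop (𝓝 (W.pSet κ k)) ∧
          Tendsto (fun t => W.instQqs κ (γ t) k) atTop (𝓝 (W.qSet κ k))) ∧
        Tendsto (fun t => W.normS2 (γ t)) atTop (𝓝 0)) := by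
  have hv' : ∀ k, W.vref k ≠ 0 := fun k => (hv k).ne'
  rcases W.tendsto_infDist_target_or_tendsto_zero hη hα hv hc hκ₀ h23 hK hsol with hT | h0
  · right
    refine ⟨W.tendsto_field_of_tendsto_infDist_target hv' hT,
      fun k => W.tendsto_nsq_of_tendsto_infDist_target hv' hT k,
      fun k => W.tendsto_instPqs_of_tendsto_infDist_target hv' κ hT k, ?_⟩
    have hΛ : W.Lam ≠ 0 := (W.Lam_pos hv).ne'
    have hne : W.target.Nonempty := by
      rw [W.target_eq_image hv']
      exact ⟨_, ⟨(1, 0), by norm_num, rfl⟩⟩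
    exact tendsto_comp_of_tendsto_infDist (W.isCompact_target hv') hne W.continuous_normS2
      (fun y hy => (W.normS2_eq_zero_iff hΛ y).2 hy.1) hT
  · exact Or.inl h0

/-! ## §12 Every non-collapsing solution of (17) converges to ONE synchronous steady state — a POINT
of `𝒮 ∩ 𝒜` — with an exponential tail (append 2026-08-27, same sources)

[GrossEtAl2019, Thm. 2 / Prop. 3 with Thm. 1] state almost-global asymptotic stability with respect
to the SET `𝒯` (here `𝒮 ∩ 𝒜`); §II-C (6) p0003 L111–L116 reads the steady state as a REST POINT of the
rotating-frame dynamics («(d/dt)v_k = ω₀Jv_k … all voltages in the power network evolve as sinusoidal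
signals with frequency ω₀»), and §V-B p0009 («Condition 2 ensures exponential phase stability of the
reduced-order system (17)», tree `normS2_le_exp_decay`). This section PROVES, from the printed
ingredients only (Prop. 3's `V̇ ≤ −α₁ψ²` (25), the (24)-type sandwich of `V`, the norm step
`‖e_θ(v)‖ ≤ ‖𝒦 − 𝓛‖‖v‖_S`), that convergence to the set upgrades to convergence to a point: on the
amplitude window `R = {v | v_k*²/2 ≤ ‖v_k‖² ≤ 2v_k*² ∀k}` — which every solution approaching `𝒮 ∩ 𝒜`
eventually inhabits — `ψ² ≥ m·V` (`psi_sq_ge`, `m = min(2η²κ₀², ηα/α₁)`) and `‖f(v)‖ ≤ K√V(v)`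
(`norm_field_le`); hence `V(v(t)) ≤ V(v(T))e^{−α₁m(t−T)}` (`V_le_mul_exp_neg`), the velocity is
exponentially small, `‖v(t) − v(s)‖ ≤ (2K√V(v(T))/(α₁m)) e^{−α₁m(s−T)/2}` for `T ≤ s ≤ t`
(`norm_sub_le_of_nearAmp`), the trajectory is Cauchy and converges to some `v_∞ ∈ 𝒮 ∩ 𝒜`
(`exists_tendsto_of_tendsto_infDist_target`) with an exponential tail (`norm_sub_lim_le`); packaged with
§3 as `tendsto_zero_or_exists_tendsto` — EVERY solution of (17) on `[0, ∞)` tends to `0` or to a single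
synchronous steady state `v_∞ = S(a, b)`, `a² + b² = 1`, i.e. in the static frame every terminal voltage
converges to the pure sinusoid `R(ω₀t)v_{∞,k}` of amplitude `v_k*` (objective (6) verbatim, together with
(7)–(8) of §§10–11). MODELLED: reduced model (17); nothing here is a grid. -/

section pointConvergence

/-- The decay modulus `m := min(2η²κ₀², ηα/α₁)` of `ψ² ≥ m V` on the amplitude window.
[cite: GrossEtAl2019, Prop. 3 (21), (24)] -/
def decayMod (c κ₀ : ℝ) : ℝ := min (2 * W.η ^ 2 * κ₀ ^ 2) (W.η * W.α / W.alpha1 c κ₀)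

/-- `m > 0` for `η, α, c, κ₀ > 0`. [cite: GrossEtAl2019, Prop. 3] -/
theorem decayMod_pos (hη : 0 < W.η) (hα : 0 < W.α) {c κ₀ : ℝ} (hc : 0 < c) (hκ₀ : 0 < κ₀) :
    0 < W.decayMod c κ₀ := by
  have hα₁ : 0 < W.alpha1 c κ₀ := by unfold alpha1; positivity
  unfold decayMod
  exact lt_min (by positivity) (by positivity)

/-- **`ψ² ≥ m·V` on the inner amplitude window** `{‖v_k‖² ≥ v_k*²/2 ∀k}`: there
`‖Φ(v)v‖² = Σ_k Φ_k²‖v_k‖² ≥ ½Σ_k (v_k*² − ‖v_k‖²)²/v_k*²`, so the comparison function (21) dominates the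
Lyapunov function (19): `ψ(v)² ≥ η²(κ₀²‖v‖²_S + α²‖Φ(v)v‖²) ≥ m(½‖v‖²_S + ½ηαα₁Σ_k(…)²/v_k*²)`
(`κ₀, η, α ≥ 0`, `α₁ > 0`, `Λ ≠ 0`, `v_k* ≠ 0`). [cite: GrossEtAl2019, Prop. 3 (21), (24), (25)] -/
theorem psi_sq_ge (hη : 0 ≤ W.η) (hα : 0 ≤ W.α) {c κ₀ : ℝ} (hκ₀ : 0 ≤ κ₀) (hα₁ : 0 < W.alpha1 c κ₀)
    (hΛ : W.Lam ≠ 0) (hne : ∀ k, W.vref k ≠ 0) {v : DvocState N}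
    (hR : ∀ k, W.vref k ^ 2 / 2 ≤ dvocNsq v k) :
    W.decayMod c κ₀ * W.V (W.alpha1 c κ₀) v ≤ W.psi κ₀ v ^ 2 := by
  set α₁ := W.alpha1 c κ₀ with hα₁def
  set m := W.decayMod c κ₀ with hmdef
  set S := W.normS2 v with hSdef
  set B := ∑ k, W.Phi v k ^ 2 * dvocNsq v k with hBdef
  set Ps := ∑ k, (W.vref k ^ 2 - dvocNsq v k) ^ 2 / W.vref k ^ 2 with hPsdef
  have hS0 : 0 ≤ S := W.normS2_nonneg hΛ v
  have hB0 : 0 ≤ B := Finset.sum_nonneg fun k _ => by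
    have : 0 ≤ dvocNsq v k := by unfold dvocNsq; positivity
    positivity
  have hPs0 : 0 ≤ Ps := Finset.sum_nonneg fun k _ => by positivity
  -- `B ≥ ½ Ps`, termwise on the window
  have hBPs : 1 / 2 * Ps ≤ B := by
    rw [hPsdef, hBdef, Finset.mul_sum]
    refine Finset.sum_le_sum fun k _ => ?_
    have hP : 0 < W.vref k ^ 2 := by have := hne k; positivity
    have key : 1 / 2 * ((W.vref k ^ 2 - dvocNsq v k) ^ 2 / W.vref k ^ 2)
        = (W.vref k ^ 2 - dvocNsq v k) ^ 2 / (W.vref k ^ 2) ^ 2 * (W.vref k ^ 2 / 2) := by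
      field_simp
    have hPhi : W.Phi v k ^ 2 * dvocNsq v k
        = (W.vref k ^ 2 - dvocNsq v k) ^ 2 / (W.vref k ^ 2) ^ 2 * dvocNsq v k := by
      unfold Phi; rw [div_pow]
    rw [key, hPhi]
    exact mul_le_mul_of_nonneg_left (hR k) (by positivity)
  -- `ψ² ≥ η²(κ₀² S + α² B)`
  have hsS : Real.sqrt S ^ 2 = S := Real.sq_sqrt hS0
  have hsB : Real.sqrt B ^ 2 = B := Real.sq_sqrt hB0
  have hcross : 0 ≤ Real.sqrt S * Real.sqrt B := mul_nonneg (Real.sqrt_nonneg _) (Real.sqrt_nonneg _)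
  have expand : W.psi κ₀ v ^ 2
      = W.η ^ 2 * (κ₀ ^ 2 * Real.sqrt S ^ 2 + W.α ^ 2 * Real.sqrt B ^ 2)
        + 2 * W.η ^ 2 * κ₀ * W.α * (Real.sqrt S * Real.sqrt B) := by
    simp only [psi, ← hSdef, ← hBdef]; ring
  rw [hsS, hsB] at expand
  have hψ : W.η ^ 2 * (κ₀ ^ 2 * S + W.α ^ 2 * B) ≤ W.psi κ₀ v ^ 2 := by
    rw [expand]
    have : 0 ≤ 2 * W.η ^ 2 * κ₀ * W.α * (Real.sqrt S * Real.sqrt B) := by positivity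
    linarith
  -- `m V ≤ η²κ₀² S + ½η²α² Ps`
  have hm1 : m ≤ 2 * W.η ^ 2 * κ₀ ^ 2 := min_le_left _ _
  have hm2' : m ≤ W.η * W.α / α₁ := min_le_right _ _
  have hm2 : m * α₁ ≤ W.η * W.α := (le_div_iff₀ hα₁).1 hm2'
  have hV : W.V α₁ v = 1 / 2 * S + 1 / 2 * W.η * W.α * α₁ * Ps := by
    simp only [V, hSdef, hPsdef]
  rw [hV]
  have hηα : 0 ≤ W.η * W.α := mul_nonneg hη hα
  have t1 : m * (1 / 2 * S) ≤ W.η ^ 2 * κ₀ ^ 2 * S := by nlinarith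
  have t2 : m * (1 / 2 * W.η * W.α * α₁ * Ps) ≤ W.η ^ 2 * W.α ^ 2 * (1 / 2 * Ps) := by
    have : m * (1 / 2 * W.η * W.α * α₁ * Ps) = 1 / 2 * (W.η * W.α) * (m * α₁) * Ps := by ring
    rw [this]
    have : W.η ^ 2 * W.α ^ 2 * (1 / 2 * Ps) = 1 / 2 * (W.η * W.α) * (W.η * W.α) * Ps := by ring
    rw [this]
    exact mul_le_mul_of_nonneg_right
      (mul_le_mul_of_nonneg_left hm2 (by positivity)) hPs0
  have t3 : W.η ^ 2 * W.α ^ 2 * (1 / 2 * Ps) ≤ W.η ^ 2 * W.α ^ 2 * B :=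
    mul_le_mul_of_nonneg_left hBPs (by positivity)
  nlinarith

/-- The velocity-bound constant `K := η√(4κ₀² + 8α/(ηα₁))` of `‖f(v)‖ ≤ K√V(v)` on the amplitude
window. [cite: GrossEtAl2019, eq. (17), (19)] -/
def fieldBoundConst (c κ₀ : ℝ) : ℝ :=
  W.η * Real.sqrt (4 * κ₀ ^ 2 + 8 * W.α / (W.η * W.alpha1 c κ₀))

/-- `K ≥ 0`. [cite: GrossEtAl2019, eq. (17)] -/
theorem fieldBoundConst_nonneg (hη : 0 ≤ W.η) (c κ₀ : ℝ) : 0 ≤ W.fieldBoundConst c κ₀ :=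
  mul_nonneg hη (Real.sqrt_nonneg _)

/-- Amplitude part of the velocity bound on the outer window `‖v_k‖² ≤ 2v_k*²`:
`Φ_k(v)²‖v_k‖² ≤ 4V(v)/(ηαα₁)` (`η α α₁ > 0`, `Λ ≠ 0`, `v_k* ≠ 0`) — from the quartic penalty of (19),
`(v_k*² − ‖v_k‖²)² ≤ (2V/(ηαα₁)) v_k*²`. [cite: GrossEtAl2019, eq. (19), Prop. 3 (24)] -/
theorem Phi_sq_nsq_le {α₁ : ℝ} (hw : 0 < W.η * W.α * α₁) (hΛ : W.Lam ≠ 0) {v : DvocState N}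
    {k : Fin N} (hk : W.vref k ≠ 0) (hR : dvocNsq v k ≤ 2 * W.vref k ^ 2) :
    W.Phi v k ^ 2 * dvocNsq v k ≤ 4 * W.V α₁ v / (W.η * W.α * α₁) := by
  set Vv := W.V α₁ v
  set A := (W.vref k ^ 2 - dvocNsq v k) ^ 2 with hA
  set P := W.vref k ^ 2 with hPdef
  have hpen : A ≤ 2 * Vv / (W.η * W.α * α₁) * P := W.penalty_le_of_V_le hΛ hw (le_refl Vv) hk
  have hP : 0 < P := by rw [hPdef]; positivity
  have hA0 : 0 ≤ A := sq_nonneg _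
  have e1 : W.Phi v k ^ 2 * dvocNsq v k = A * dvocNsq v k / P ^ 2 := by
    simp only [Phi, hA, hPdef]; rw [div_pow]; ring
  rw [e1, div_le_iff₀ (by positivity)]
  calc A * dvocNsq v k ≤ A * (2 * P) := mul_le_mul_of_nonneg_left hR hA0
    _ ≤ 2 * Vv / (W.η * W.α * α₁) * P * (2 * P) := mul_le_mul_of_nonneg_right hpen (by positivity)
    _ = 4 * Vv / (W.η * W.α * α₁) * P ^ 2 := by ring

/-- Coordinate velocity bound on the outer amplitude window `{‖v_k‖² ≤ 2v_k*²}`: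
`(ηg_{k,i}(v))² ≤ K²V(v)` for both coordinates — from `‖e_θ(v)‖² ≤ κ₀²‖v‖²_S ≤ 2κ₀²V`
and `(Φ_kv_{k,i})² ≤ Φ_k²‖v_k‖² ≤ 4V/(ηαα₁)` (`η, α > 0`, `α₁ > 0`, `Λ ≠ 0`, `v_k* ≠ 0`,
`PhaseErrorBound κ₀`). [cite: GrossEtAl2019, eq. (17), (19), proof of Prop. 3] -/
theorem field_coord_sq_le (hη : 0 < W.η) (hα : 0 < W.α) {c κ₀ : ℝ} (hα₁ : 0 < W.alpha1 c κ₀)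
    (hΛ : W.Lam ≠ 0) (hne : ∀ k, W.vref k ≠ 0) (hK : W.PhaseErrorBound κ₀) {v : DvocState N}
    (hR : ∀ k, dvocNsq v k ≤ 2 * W.vref k ^ 2) (k : Fin N) :
    (W.η * W.g₁ v k) ^ 2 ≤ W.fieldBoundConst c κ₀ ^ 2 * W.V (W.alpha1 c κ₀) v ∧
      (W.η * W.g₂ v k) ^ 2 ≤ W.fieldBoundConst c κ₀ ^ 2 * W.V (W.alpha1 c κ₀) v := by
  set α₁ := W.alpha1 c κ₀ with hα₁def
  set Vv := W.V α₁ v with hVdef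
  have hw : 0 < W.η * W.α * α₁ := by positivity
  -- `K² = η²(4κ₀² + 8α/(ηα₁))`
  have hrad : 0 ≤ 4 * κ₀ ^ 2 + 8 * W.α / (W.η * α₁) := by positivity
  have hK2 : W.fieldBoundConst c κ₀ ^ 2 = W.η ^ 2 * (4 * κ₀ ^ 2 + 8 * W.α / (W.η * α₁)) := by
    unfold fieldBoundConst; rw [mul_pow, ← hα₁def, Real.sq_sqrt hrad]
  -- phase-error coordinates: `e_{θ,k,i}² ≤ κ₀² S ≤ 2κ₀² V`
  have hS : W.normS2 v ≤ 2 * Vv := W.normS2_le_of_V_le hw.le le_rfl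
  have hsum := hK v
  have hterm : W.eθ₁ v k ^ 2 + W.eθ₂ v k ^ 2 ≤ ∑ j, (W.eθ₁ v j ^ 2 + W.eθ₂ v j ^ 2) :=
    Finset.single_le_sum (f := fun j => W.eθ₁ v j ^ 2 + W.eθ₂ v j ^ 2) (fun j _ => by positivity)
      (Finset.mem_univ k)
  have hκ2 : 0 ≤ κ₀ ^ 2 := sq_nonneg _
  have he : W.eθ₁ v k ^ 2 + W.eθ₂ v k ^ 2 ≤ 2 * κ₀ ^ 2 * Vv := by
    have := mul_le_mul_of_nonneg_left hS hκ2
    linarith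
  -- amplitude coordinates
  have hΦsq : W.Phi v k ^ 2 * dvocNsq v k ≤ 4 * Vv / (W.η * W.α * α₁) :=
    W.Phi_sq_nsq_le hw hΛ (hne k) (hR k)
  have hΦ1 : (W.Phi v k * v.1 k) ^ 2 ≤ 4 * Vv / (W.η * W.α * α₁) := by
    refine le_trans ?_ hΦsq
    rw [mul_pow]; unfold dvocNsq
    refine mul_le_mul_of_nonneg_left ?_ (sq_nonneg _)
    have := sq_nonneg (v.2 k); linarith
  have hΦ2 : (W.Phi v k * v.2 k) ^ 2 ≤ 4 * Vv / (W.η * W.α * α₁) := by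
    refine le_trans ?_ hΦsq
    rw [mul_pow]; unfold dvocNsq
    refine mul_le_mul_of_nonneg_left ?_ (sq_nonneg _)
    have := sq_nonneg (v.1 k); linarith
  -- assemble: `(ηg)² ≤ η²·2(e² + α²(Φv)²) ≤ η²(4κ₀² + 8α/(ηα₁)) V`
  have h8 : W.α ^ 2 * (4 * Vv / (W.η * W.α * α₁)) = 4 * W.α / (W.η * α₁) * Vv := by
    field_simp
  have hα2 : 0 ≤ W.α ^ 2 := sq_nonneg _
  have hη2 : 0 ≤ W.η ^ 2 := sq_nonneg _
  have he1 : W.eθ₁ v k ^ 2 ≤ 2 * κ₀ ^ 2 * Vv := by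
    have := sq_nonneg (W.eθ₂ v k); linarith
  have he2 : W.eθ₂ v k ^ 2 ≤ 2 * κ₀ ^ 2 * Vv := by
    have := sq_nonneg (W.eθ₁ v k); linarith
  have hq1 : W.α ^ 2 * (W.Phi v k * v.1 k) ^ 2 ≤ 4 * W.α / (W.η * α₁) * Vv := by
    rw [← h8]; exact mul_le_mul_of_nonneg_left hΦ1 hα2
  have hq2 : W.α ^ 2 * (W.Phi v k * v.2 k) ^ 2 ≤ 4 * W.α / (W.η * α₁) * Vv := by
    rw [← h8]; exact mul_le_mul_of_nonneg_left hΦ2 hα2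
  have hsplit : (4 * κ₀ ^ 2 + 8 * W.α / (W.η * α₁)) * Vv
      = 2 * (2 * κ₀ ^ 2 * Vv) + 2 * (4 * W.α / (W.η * α₁) * Vv) := by ring
  -- `(a + b)² ≤ 2a² + 2b²`
  have two_sq : ∀ a b : ℝ, (a + b) ^ 2 ≤ 2 * a ^ 2 + 2 * b ^ 2 := fun a b => by
    nlinarith [sq_nonneg (a - b)]
  rw [hK2]
  constructor
  · have hsq1 : (W.η * W.g₁ v k) ^ 2 = W.η ^ 2 * (W.eθ₁ v k + W.α * (W.Phi v k * v.1 k)) ^ 2 := by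
      unfold g₁; ring
    have hin : (W.eθ₁ v k + W.α * (W.Phi v k * v.1 k)) ^ 2
        ≤ (4 * κ₀ ^ 2 + 8 * W.α / (W.η * α₁)) * Vv := by
      have h := two_sq (W.eθ₁ v k) (W.α * (W.Phi v k * v.1 k))
      rw [mul_pow] at h
      rw [hsplit]
      linarith
    calc (W.η * W.g₁ v k) ^ 2 = W.η ^ 2 * (W.eθ₁ v k + W.α * (W.Phi v k * v.1 k)) ^ 2 := hsq1
      _ ≤ W.η ^ 2 * ((4 * κ₀ ^ 2 + 8 * W.α / (W.η * α₁)) * Vv) :=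
          mul_le_mul_of_nonneg_left hin hη2
      _ = W.η ^ 2 * (4 * κ₀ ^ 2 + 8 * W.α / (W.η * α₁)) * Vv := by ring
  · have hsq2 : (W.η * W.g₂ v k) ^ 2 = W.η ^ 2 * (W.eθ₂ v k + W.α * (W.Phi v k * v.2 k)) ^ 2 := by
      unfold g₂; ring
    have hin : (W.eθ₂ v k + W.α * (W.Phi v k * v.2 k)) ^ 2
        ≤ (4 * κ₀ ^ 2 + 8 * W.α / (W.η * α₁)) * Vv := by
      have h := two_sq (W.eθ₂ v k) (W.α * (W.Phi v k * v.2 k))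
      rw [mul_pow] at h
      rw [hsplit]
      linarith
    calc (W.η * W.g₂ v k) ^ 2 = W.η ^ 2 * (W.eθ₂ v k + W.α * (W.Phi v k * v.2 k)) ^ 2 := hsq2
      _ ≤ W.η ^ 2 * ((4 * κ₀ ^ 2 + 8 * W.α / (W.η * α₁)) * Vv) :=
          mul_le_mul_of_nonneg_left hin hη2
      _ = W.η ^ 2 * (4 * κ₀ ^ 2 + 8 * W.α / (W.η * α₁)) * Vv := by ring

/-- **Velocity bound `‖f(v)‖ ≤ K√V(v)`** (sup norm of the tree's state space) on the outer amplitude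
window `{‖v_k‖² ≤ 2v_k*² ∀k}`. [cite: GrossEtAl2019, eq. (17), (19), proof of Prop. 3] -/
theorem norm_field_le (hη : 0 < W.η) (hα : 0 < W.α) {c κ₀ : ℝ} (hα₁ : 0 < W.alpha1 c κ₀)
    (hΛ : W.Lam ≠ 0) (hne : ∀ k, W.vref k ≠ 0) (hK : W.PhaseErrorBound κ₀) {v : DvocState N}
    (hR : ∀ k, dvocNsq v k ≤ 2 * W.vref k ^ 2) :
    ‖W.field v‖ ≤ W.fieldBoundConst c κ₀ * Real.sqrt (W.V (W.alpha1 c κ₀) v) := by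
  set Kf := W.fieldBoundConst c κ₀
  have hKf : 0 ≤ Kf := W.fieldBoundConst_nonneg hη.le c κ₀
  have hw : 0 < W.η * W.α * W.alpha1 c κ₀ := by positivity
  have hV0 : 0 ≤ W.V (W.alpha1 c κ₀) v := W.V_nonneg hΛ hw.le v
  have hrhs : 0 ≤ Kf * Real.sqrt (W.V (W.alpha1 c κ₀) v) := mul_nonneg hKf (Real.sqrt_nonneg _)
  have hsq : (Kf * Real.sqrt (W.V (W.alpha1 c κ₀) v)) ^ 2 = Kf ^ 2 * W.V (W.alpha1 c κ₀) v := by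
    rw [mul_pow, Real.sq_sqrt hV0]
  have coord : ∀ x : ℝ, x ^ 2 ≤ Kf ^ 2 * W.V (W.alpha1 c κ₀) v →
      ‖x‖ ≤ Kf * Real.sqrt (W.V (W.alpha1 c κ₀) v) := fun x hx => by
    rw [Real.norm_eq_abs]
    exact abs_le_of_sq_le_sq (by rw [hsq]; exact hx) hrhs
  rw [Prod.norm_def, max_le_iff]
  constructor
  · refine (pi_norm_le_iff_of_nonneg hrhs).2 fun k => coord _ ?_
    exact (W.field_coord_sq_le hη hα hα₁ hΛ hne hK hR k).1
  · refine (pi_norm_le_iff_of_nonneg hrhs).2 fun k => coord _ ?_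
    exact (W.field_coord_sq_le hη hα hα₁ hΛ hne hK hR k).2

/-- Along a curve approaching `𝒮 ∩ 𝒜` the amplitudes eventually stay in the window
`v_k*²/2 ≤ ‖v_k(t)‖² ≤ 2v_k*²` (all `k`; `N ≥ 1`, `v_k* ≠ 0`). [cite: GrossEtAl2019, §II-C (7) with
§IV-A (16)] -/
theorem exists_forall_nearAmp [NeZero N] (hne : ∀ k, W.vref k ≠ 0) {γ : ℝ → DvocState N}
    (hT : Tendsto (fun t => infDist (γ t) W.target) atTop (𝓝 0)) :
    ∃ T, 0 ≤ T ∧ ∀ t, T ≤ t → ∀ k,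
      W.vref k ^ 2 / 2 ≤ dvocNsq (γ t) k ∧ dvocNsq (γ t) k ≤ 2 * W.vref k ^ 2 := by
  have hk : ∀ k, ∀ᶠ t in atTop,
      W.vref k ^ 2 / 2 ≤ dvocNsq (γ t) k ∧ dvocNsq (γ t) k ≤ 2 * W.vref k ^ 2 := by
    intro k
    have hP : 0 < W.vref k ^ 2 := by have := hne k; positivity
    have hlim := W.tendsto_nsq_of_tendsto_infDist_target hne hT k
    have hmem : Set.Icc (W.vref k ^ 2 / 2) (2 * W.vref k ^ 2) ∈ 𝓝 (W.vref k ^ 2) :=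
      Icc_mem_nhds (by linarith) (by linarith)
    exact (hlim.eventually hmem).mono fun t ht => ⟨ht.1, ht.2⟩
  have hall := (Filter.eventually_all.2 hk).and (eventually_ge_atTop (0 : ℝ))
  obtain ⟨T, hT'⟩ := Filter.eventually_atTop.1 hall
  exact ⟨max T 0, le_max_right _ _, fun t ht k => (hT' t ((le_max_left _ _).trans ht)).1 k⟩

/-- **Exponential decay of `V` once the amplitudes are in the window**: along a solution of (17) on
`[0, ∞)` with `‖v_k(τ)‖² ≥ v_k*²/2` for all `τ ≥ T ≥ 0`,
`V(v(t)) ≤ V(v(T)) e^{−α₁m(t−T)}` for `t ≥ T` (Prop. 3's `V̇ ≤ −α₁ψ²` and `ψ² ≥ mV`; hypotheses of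
`tendsto_infDist_target_or_tendsto_zero`). [cite: GrossEtAl2019, Prop. 3 (25); §V-B («exponential phase
stability»)] MODELLED: reduced model (17). -/
theorem V_le_mul_exp_neg [NeZero N] (hη : 0 < W.η) (hα : 0 < W.α) (hv : ∀ k, 0 < W.vref k)
    {c κ₀ : ℝ} (hc : 0 < c) (hκ₀ : 0 < κ₀) (h23 : W.DecreaseOnS c) (hK : W.PhaseErrorBound κ₀)
    {γ : ℝ → DvocState N} (hsol : W.IsSolutionOn γ (Ici 0)) {T : ℝ} (hT0 : 0 ≤ T)
    (hR : ∀ τ, T ≤ τ → ∀ k, W.vref k ^ 2 / 2 ≤ dvocNsq (γ τ) k) {t : ℝ} (ht : T ≤ t) :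
    W.V (W.alpha1 c κ₀) (γ t)
      ≤ W.V (W.alpha1 c κ₀) (γ T) * Real.exp (-(W.alpha1 c κ₀ * W.decayMod c κ₀) * (t - T)) := by
  set α₁ := W.alpha1 c κ₀ with hα₁def
  set m := W.decayMod c κ₀ with hmdef
  set μ := α₁ * m with hμ
  have hα₁ : 0 < α₁ := by rw [hα₁def]; unfold alpha1; positivity
  have hΛ : W.Lam ≠ 0 := (W.Lam_pos hv).ne'
  have hne : ∀ k, W.vref k ≠ 0 := fun k => (hv k).ne'
  -- `g(τ) := e^{μτ} V(γ τ)` is antitone on `[T, t]`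
  have hd : ∀ τ ∈ Icc T t, HasDerivWithinAt (fun σ => Real.exp (μ * σ) * W.V α₁ (γ σ))
      (Real.exp (μ * τ) * (μ * 1) * W.V α₁ (γ τ) + Real.exp (μ * τ) * W.Vdot α₁ (γ τ))
      (Icc T t) τ := by
    intro τ hτ
    have hγ : HasDerivWithinAt γ (W.field (γ τ)) (Icc T t) τ :=
      (hsol τ (show τ ∈ Ici (0 : ℝ) from hT0.trans hτ.1)).mono fun σ hσ => hT0.trans hσ.1
    have he : HasDerivWithinAt (fun σ => Real.exp (μ * σ)) (Real.exp (μ * τ) * (μ * 1)) (Icc T t) τ :=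
      (((hasDerivAt_id τ).const_mul μ).exp).hasDerivWithinAt
    exact he.mul (W.hasDerivWithinAt_V α₁ hγ)
  have hanti : AntitoneOn (fun σ => Real.exp (μ * σ) * W.V α₁ (γ σ)) (Icc T t) := by
    refine antitoneOn_of_hasDerivWithinAt_nonpos (convex_Icc T t)
      (fun τ hτ => (hd τ hτ).continuousWithinAt)
      (fun τ hτ => (hd τ (interior_subset hτ)).mono interior_subset) (fun τ hτ => ?_)
    have hτT : T ≤ τ := (interior_subset (s := Icc T t) hτ).1
    have hψ := W.psi_sq_ge hη.le hα.le hκ₀.le hα₁ hΛ hne (hR τ hτT)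
    have hVd := W.Vdot_le_neg_alpha1_psi_sq hη hα.le hv hc hκ₀ h23 hK (γ τ)
    have he0 : 0 < Real.exp (μ * τ) := Real.exp_pos _
    have key : Real.exp (μ * τ) * (μ * 1) * W.V α₁ (γ τ) + Real.exp (μ * τ) * W.Vdot α₁ (γ τ)
        = Real.exp (μ * τ) * (α₁ * (m * W.V α₁ (γ τ)) + W.Vdot α₁ (γ τ)) := by
      rw [hμ]; ring
    rw [key]
    refine mul_nonpos_iff.2 (Or.inl ⟨he0.le, ?_⟩)
    nlinarith [mul_le_mul_of_nonneg_left hψ hα₁.le]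
  have hmono := hanti (left_mem_Icc.2 ht) (right_mem_Icc.2 ht) ht
  -- unfold `e^{μt} V(γ t) ≤ e^{μT} V(γ T)`
  have he0 : 0 < Real.exp (-(μ * t)) := Real.exp_pos _
  have hprod : Real.exp (-(μ * t)) * Real.exp (μ * t) = 1 := by
    rw [← Real.exp_add, neg_add_cancel, Real.exp_zero]
  calc W.V α₁ (γ t) = Real.exp (-(μ * t)) * (Real.exp (μ * t) * W.V α₁ (γ t)) := by
        rw [← mul_assoc, hprod, one_mul]
    _ ≤ Real.exp (-(μ * t)) * (Real.exp (μ * T) * W.V α₁ (γ T)) :=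
        mul_le_mul_of_nonneg_left hmono he0.le
    _ = W.V α₁ (γ T) * Real.exp (-(α₁ * m) * (t - T)) := by
        rw [← mul_assoc, ← Real.exp_add, hμ]
        ring_nf

/-- A solution of (17) on `[0, ∞)` is continuous on `[0, ∞)` (Summits-side twin:
`Summit.Ventures.GridStability.Lyapunov.DvocReducedRoa.continuousOn_of_isSolutionOn`; restated because
Literature cannot import Summits). [cite: GrossEtAl2019, eq. (17)] -/
theorem continuousOn_of_isSolutionOn {γ : ℝ → DvocState N} (hsol : W.IsSolutionOn γ (Ici 0)) :
    ContinuousOn γ (Ici 0) := fun t ht => (hsol t ht).continuousWithinAt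

/-- **The displacement after time `s` is exponentially small**: with the amplitude window holding on
`[T, ∞)` (`T ≥ 0`), for `T ≤ s ≤ t`,
`‖v(t) − v(s)‖ ≤ (2K√V(v(T))/(α₁m)) · e^{−(α₁m/2)(s−T)}` — the mean-value inequality with the
velocity bound `‖f(v(τ))‖ ≤ K√V(v(τ)) ≤ K√V(v(T)) e^{−(α₁m/2)(τ−T)}`. [cite: GrossEtAl2019, Prop. 3
with (17)] MODELLED: reduced model (17). -/
theorem norm_sub_le_of_nearAmp [NeZero N] (hη : 0 < W.η) (hα : 0 < W.α) (hv : ∀ k, 0 < W.vref k)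
    {c κ₀ : ℝ} (hc : 0 < c) (hκ₀ : 0 < κ₀) (h23 : W.DecreaseOnS c) (hK : W.PhaseErrorBound κ₀)
    {γ : ℝ → DvocState N} (hsol : W.IsSolutionOn γ (Ici 0)) {T : ℝ} (hT0 : 0 ≤ T)
    (hR : ∀ τ, T ≤ τ → ∀ k,
      W.vref k ^ 2 / 2 ≤ dvocNsq (γ τ) k ∧ dvocNsq (γ τ) k ≤ 2 * W.vref k ^ 2)
    {s t : ℝ} (hs : T ≤ s) (hst : s ≤ t) :
    ‖γ t - γ s‖ ≤ 2 * W.fieldBoundConst c κ₀ * Real.sqrt (W.V (W.alpha1 c κ₀) (γ T))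
        / (W.alpha1 c κ₀ * W.decayMod c κ₀)
        * Real.exp (-(W.alpha1 c κ₀ * W.decayMod c κ₀ / 2) * (s - T)) := by
  set α₁ := W.alpha1 c κ₀ with hα₁def
  set m := W.decayMod c κ₀ with hmdef
  set μ := α₁ * m with hμ
  set Kf := W.fieldBoundConst c κ₀ with hKfdef
  set VT := W.V α₁ (γ T) with hVT
  have hα₁ : 0 < α₁ := by rw [hα₁def]; unfold alpha1; positivity
  have hm : 0 < m := W.decayMod_pos hη hα hc hκ₀
  have hμ0 : 0 < μ := mul_pos hα₁ hm
  have hΛ : W.Lam ≠ 0 := (W.Lam_pos hv).ne'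
  have hne : ∀ k, W.vref k ≠ 0 := fun k => (hv k).ne'
  have hKf : 0 ≤ Kf := W.fieldBoundConst_nonneg hη.le c κ₀
  set C := Kf * Real.sqrt VT * (2 / μ) with hC
  have h2μ : 2 / μ * (μ / 2) = 1 := by
    rw [div_mul_div_comm, mul_comm 2 μ, div_self (mul_ne_zero hμ0.ne' two_ne_zero)]
  -- the boundary function `B(τ) = C (e^{−(μ/2)(s−T)} − e^{−(μ/2)(τ−T)})`, `B' = Kf √VT e^{−(μ/2)(τ−T)}`
  set B : ℝ → ℝ := fun τ => C * (Real.exp (-(μ / 2) * (s - T)) - Real.exp (-(μ / 2) * (τ - T)))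
    with hBdef
  set B' : ℝ → ℝ := fun τ => Kf * Real.sqrt VT * Real.exp (-(μ / 2) * (τ - T)) with hB'def
  have hB : ∀ x, HasDerivAt B (B' x) x := by
    intro x
    have h1 : HasDerivAt (fun τ => -(μ / 2) * (τ - T)) (-(μ / 2) * 1) x :=
      ((hasDerivAt_id x).sub_const T).const_mul _
    have h2 := (h1.exp.const_sub (Real.exp (-(μ / 2) * (s - T)))).const_mul C
    refine h2.congr_deriv ?_
    rw [hB'def]
    calc C * -(Real.exp (-(μ / 2) * (x - T)) * (-(μ / 2) * 1))
        = Kf * Real.sqrt VT * Real.exp (-(μ / 2) * (x - T)) * (2 / μ * (μ / 2)) := by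
          rw [hC]; ring
      _ = Kf * Real.sqrt VT * Real.exp (-(μ / 2) * (x - T)) := by rw [h2μ, mul_one]
  have hcont : ContinuousOn (fun τ => γ τ - γ s) (Icc s t) :=
    ((W.continuousOn_of_isSolutionOn hsol).mono fun τ hτ => hT0.trans (hs.trans hτ.1)).sub
      continuousOn_const
  have hderiv : ∀ x ∈ Ico s t, HasDerivWithinAt (fun τ => γ τ - γ s) (W.field (γ x)) (Ici x) x := by
    intro x hx
    have h0x : (0 : ℝ) ≤ x := hT0.trans (hs.trans hx.1)
    exact ((hsol x h0x).mono fun σ hσ => h0x.trans hσ).sub_const _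
  have hbound : ∀ x ∈ Ico s t, ‖W.field (γ x)‖ ≤ B' x := by
    intro x hx
    have hTx : T ≤ x := hs.trans hx.1
    have h1 := W.norm_field_le hη hα hα₁ hΛ hne hK (fun k => (hR x hTx k).2)
    have h2 := W.V_le_mul_exp_neg hη hα hv hc hκ₀ h23 hK hsol hT0 (fun τ hτ k => (hR τ hτ k).1) hTx
    have hw : 0 < W.η * W.α * α₁ := by positivity
    have hV0 : 0 ≤ VT := W.V_nonneg hΛ hw.le _
    -- `√V(γ x) ≤ √VT · e^{−(μ/2)(x−T)}`
    have h3 : Real.sqrt (W.V α₁ (γ x)) ≤ Real.sqrt VT * Real.exp (-(μ / 2) * (x - T)) := by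
      have hsq : (Real.sqrt VT * Real.exp (-(μ / 2) * (x - T))) ^ 2
          = VT * Real.exp (-(α₁ * m) * (x - T)) := by
        rw [mul_pow, Real.sq_sqrt hV0, ← Real.exp_nat_mul, hμ]
        congr 1; push_cast; ring
      have hnn : 0 ≤ Real.sqrt VT * Real.exp (-(μ / 2) * (x - T)) :=
        mul_nonneg (Real.sqrt_nonneg _) (Real.exp_pos _).le
      rw [← Real.sqrt_sq hnn, hsq]
      exact Real.sqrt_le_sqrt h2
    calc ‖W.field (γ x)‖ ≤ Kf * Real.sqrt (W.V α₁ (γ x)) := h1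
      _ ≤ Kf * (Real.sqrt VT * Real.exp (-(μ / 2) * (x - T))) := mul_le_mul_of_nonneg_left h3 hKf
      _ = B' x := by rw [hB'def]; ring
  have hmain := image_norm_le_of_norm_deriv_right_le_deriv_boundary hcont hderiv
    (B := B) (B' := B') (by simp [hBdef]) hB hbound (right_mem_Icc.2 hst)
  have hdrop : B t ≤ C * Real.exp (-(μ / 2) * (s - T)) := by
    have hCnn : 0 ≤ C := by rw [hC]; positivity
    have : 0 ≤ C * Real.exp (-(μ / 2) * (t - T)) := mul_nonneg hCnn (Real.exp_pos _).le
    simp only [hBdef]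
    nlinarith
  calc ‖γ t - γ s‖ ≤ B t := hmain
    _ ≤ C * Real.exp (-(μ / 2) * (s - T)) := hdrop
    _ = 2 * Kf * Real.sqrt VT / (α₁ * m) * Real.exp (-(α₁ * m / 2) * (s - T)) := by
        rw [hC, hμ]; ring

/-- **Convergence to ONE synchronous steady state.** Under the hypotheses of
`tendsto_infDist_target_or_tendsto_zero`, every solution of (17) on `[0, ∞)` that approaches
`𝒮 ∩ 𝒜` converges to a POINT `v_∞ ∈ 𝒮 ∩ 𝒜` — in the rotating frame a rest point, in the static
frame the sinusoid `R(ω₀t)v_∞` at every converter (objective (6)). [cite: GrossEtAl2019, Thm. 2 / Prop. 3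
with §II-C (6) and §V-B] MODELLED: reduced model (17); nothing here is a grid. -/
theorem exists_tendsto_of_tendsto_infDist_target [NeZero N] (hη : 0 < W.η) (hα : 0 < W.α)
    (hv : ∀ k, 0 < W.vref k) {c κ₀ : ℝ} (hc : 0 < c) (hκ₀ : 0 < κ₀) (h23 : W.DecreaseOnS c)
    (hK : W.PhaseErrorBound κ₀) {γ : ℝ → DvocState N} (hsol : W.IsSolutionOn γ (Ici 0))
    (hT : Tendsto (fun t => infDist (γ t) W.target) atTop (𝓝 0)) :
    ∃ v, v ∈ W.target ∧ Tendsto γ atTop (𝓝 v) := by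
  have hne : ∀ k, W.vref k ≠ 0 := fun k => (hv k).ne'
  obtain ⟨T, hT0, hR⟩ := W.exists_forall_nearAmp hne hT
  set α₁ := W.alpha1 c κ₀ with hα₁def
  set m := W.decayMod c κ₀ with hmdef
  set C := 2 * W.fieldBoundConst c κ₀ * Real.sqrt (W.V α₁ (γ T)) / (α₁ * m) with hC
  have hα₁ : 0 < α₁ := by rw [hα₁def]; unfold alpha1; positivity
  have hm : 0 < m := W.decayMod_pos hη hα hc hκ₀
  have hμ2 : 0 < α₁ * m / 2 := by positivity
  have hCnn : 0 ≤ C := by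
    rw [hC]
    have := W.fieldBoundConst_nonneg hη.le c κ₀
    positivity
  have hdisp : ∀ s t, T ≤ s → s ≤ t →
      ‖γ t - γ s‖ ≤ C * Real.exp (-(α₁ * m / 2) * (s - T)) := fun s t hs hst =>
    W.norm_sub_le_of_nearAmp hη hα hv hc hκ₀ h23 hK hsol hT0 hR hs hst
  -- the tail bound tends to `0`
  have htail : Tendsto (fun s => C * Real.exp (-(α₁ * m / 2) * (s - T))) atTop (𝓝 0) := by
    have h1 : Tendsto (fun s : ℝ => -(α₁ * m / 2) * (s - T)) atTop atBot := by
      have : Tendsto (fun s : ℝ => s - T) atTop atTop := tendsto_atTop_add_const_right _ _ tendsto_id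
      exact this.const_mul_atTop_of_neg (by linarith)
    have h2 := Real.tendsto_exp_atBot.comp h1
    simpa using h2.const_mul C
  -- Cauchy along `atTop`
  have hcauchy : Cauchy (map γ atTop) := by
    refine Metric.cauchy_iff.2 ⟨map_neBot, fun ε hε => ?_⟩
    have hev : ∀ᶠ s in atTop, C * Real.exp (-(α₁ * m / 2) * (s - T)) < ε / 2 :=
      (tendsto_order.1 htail).2 _ (by linarith)
    obtain ⟨s₀, hs₀⟩ := Filter.eventually_atTop.1 (hev.and (eventually_ge_atTop T))
    refine ⟨γ '' Ici s₀, image_mem_map (Ici_mem_atTop s₀), ?_⟩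
    rintro x ⟨a, ha, rfl⟩ y ⟨b, hb, rfl⟩
    obtain ⟨h0, hT'⟩ := hs₀ s₀ le_rfl
    have h1 := hdisp s₀ a hT' ha
    have h2 := hdisp s₀ b hT' hb
    calc dist (γ a) (γ b) = ‖(γ a - γ s₀) - (γ b - γ s₀)‖ := by rw [dist_eq_norm]; congr 1; abel
      _ ≤ ‖γ a - γ s₀‖ + ‖γ b - γ s₀‖ := norm_sub_le _ _
      _ < ε := by linarith
  obtain ⟨v, hvlim⟩ := cauchy_map_iff_exists_tendsto.1 hcauchy
  refine ⟨v, ?_, hvlim⟩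
  -- the limit lies in the closed set `𝒮 ∩ 𝒜`
  have hTne : W.target.Nonempty := by
    rw [W.target_eq_image hne]
    exact ⟨_, ⟨(1, 0), by norm_num, rfl⟩⟩
  have hlim2 : Tendsto (fun t => infDist (γ t) W.target) atTop (𝓝 (infDist v W.target)) :=
    ((continuous_infDist_pt W.target).tendsto v).comp hvlim
  have h0 : infDist v W.target = 0 := tendsto_nhds_unique hlim2 hT
  exact ((W.isCompact_target hne).isClosed.mem_iff_infDist_zero hTne).2 h0

/-- **Exponential tail of the convergence**: with `v_∞` the limit, `T` a time from which the
amplitude window holds, and `C = 2K√V(v(T))/(α₁m)`, for every `s ≥ T`: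
`‖v_∞ − v(s)‖ ≤ C e^{−(α₁m/2)(s−T)}`. [cite: GrossEtAl2019, Prop. 3 with §V-B («exponential phase
stability»)] MODELLED: reduced model (17). -/
theorem norm_sub_lim_le [NeZero N] (hη : 0 < W.η) (hα : 0 < W.α) (hv : ∀ k, 0 < W.vref k)
    {c κ₀ : ℝ} (hc : 0 < c) (hκ₀ : 0 < κ₀) (h23 : W.DecreaseOnS c) (hK : W.PhaseErrorBound κ₀)
    {γ : ℝ → DvocState N} (hsol : W.IsSolutionOn γ (Ici 0)) {T : ℝ} (hT0 : 0 ≤ T)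
    (hR : ∀ τ, T ≤ τ → ∀ k,
      W.vref k ^ 2 / 2 ≤ dvocNsq (γ τ) k ∧ dvocNsq (γ τ) k ≤ 2 * W.vref k ^ 2)
    {v : DvocState N} (hlim : Tendsto γ atTop (𝓝 v)) {s : ℝ} (hs : T ≤ s) :
    ‖v - γ s‖ ≤ 2 * W.fieldBoundConst c κ₀ * Real.sqrt (W.V (W.alpha1 c κ₀) (γ T))
        / (W.alpha1 c κ₀ * W.decayMod c κ₀)
        * Real.exp (-(W.alpha1 c κ₀ * W.decayMod c κ₀ / 2) * (s - T)) := by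
  have hcont : Tendsto (fun t => ‖γ t - γ s‖) atTop (𝓝 ‖v - γ s‖) :=
    (continuous_norm.tendsto _).comp (hlim.sub_const (γ s))
  refine le_of_tendsto hcont ?_
  filter_upwards [eventually_ge_atTop s] with t hst
  exact W.norm_sub_le_of_nearAmp hη hα hv hc hκ₀ h23 hK hsol hT0 hR hs hst

/-- **THE DICHOTOMY, POINTWISE FORM** [cite: GrossEtAl2019, Prop. 3 with Thm. 1 / Thm. 2, §II-C (6)]:
under the hypotheses of `tendsto_infDist_target_or_tendsto_zero`, EVERY solution of the reduced dVOC
model (17) on `[0, ∞)` converges — either to `0` (voltage collapse, the print's measure-zero exception)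
or to a single synchronous steady state `v_∞ ∈ 𝒮 ∩ 𝒜` (`v_∞ = S(a, b)` with `a² + b² = 1`: all
converters phase-locked at the prescribed relative angles with amplitudes `v_k*`, rotating at `ω₀` in
the static frame). MODELLED: reduced model (17); nothing here is a grid, and no declaration says
«stable». -/
theorem tendsto_zero_or_exists_tendsto [NeZero N] (hη : 0 < W.η) (hα : 0 < W.α)
    (hv : ∀ k, 0 < W.vref k) {c κ₀ : ℝ} (hc : 0 < c) (hκ₀ : 0 < κ₀) (h23 : W.DecreaseOnS c)
    (hK : W.PhaseErrorBound κ₀) {γ : ℝ → DvocState N} (hsol : W.IsSolutionOn γ (Ici 0)) :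
    Tendsto γ atTop (𝓝 0) ∨ ∃ v, v ∈ W.target ∧ Tendsto γ atTop (𝓝 v) := by
  rcases W.tendsto_infDist_target_or_tendsto_zero hη hα hv hc hκ₀ h23 hK hsol with hT | h0
  · exact Or.inr (W.exists_tendsto_of_tendsto_infDist_target hη hα hv hc hκ₀ h23 hK hsol hT)
  · exact Or.inl h0

/-- **Region of attraction, pointwise form**: every solution of (17) on `[0, ∞)` with
`V(v(0)) < V(0)` (`= ½ηαα₁Σ_k v_k*²`, tree `V_zero`) converges to a single point of `𝒮 ∩ 𝒜`. [cite: GrossEtAl2019,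
Prop. 3 with Thm. 1] MODELLED: reduced model (17). -/
theorem exists_tendsto_of_V_lt [NeZero N] (hη : 0 < W.η) (hα : 0 < W.α) (hv : ∀ k, 0 < W.vref k)
    {c κ₀ : ℝ} (hc : 0 < c) (hκ₀ : 0 < κ₀) (h23 : W.DecreaseOnS c) (hK : W.PhaseErrorBound κ₀)
    {γ : ℝ → DvocState N} (hsol : W.IsSolutionOn γ (Ici 0))
    (hlt : W.V (W.alpha1 c κ₀) (γ 0) < W.V (W.alpha1 c κ₀) 0) :
    ∃ v, v ∈ W.target ∧ Tendsto γ atTop (𝓝 v) :=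
  W.exists_tendsto_of_tendsto_infDist_target hη hα hv hc hκ₀ h23 hK hsol
    (W.tendsto_infDist_target_of_V_lt hη hα hv hc hκ₀ h23 hK hsol hlt)

end pointConvergence

end DvocReduced

end Literature.MathematicalPhysics.PowerSystems
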